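import Literature.NumberTheory.EllipticCurves.ShintaniGenericLift32
import Literature.NumberTheory.EllipticCurves.ShintaniIndefiniteStabilizersB
import Literature.NumberTheory.EllipticCurves.ShintaniAnisotropicOrbits
import Literature.NumberTheory.EllipticCurves.ShintaniSplitStabilizers
import Literature.NumberTheory.EllipticCurves.ShintaniSplitOrbits
import Literature.NumberTheory.EllipticCurves.ShintaniSplitPeriods
import Literature.NumberTheory.EllipticCurves.ShintaniLiftQExpansion
import Literature.NumberTheory.EllipticCurves.ShintaniSplitOrbitCoefficients
import Literature.NumberTheory.EllipticCurves.ShintaniLiftHolomorphy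
import Mathlib.NumberTheory.Pell
import Mathlib.GroupTheory.Archimedean
import HarnessLib

/-!
# The indefinite orbits and the `q`-expansion of the generic level-`32` lift `Φ[c, t]`

[[cite: Shintani1975, §2, Props. 2.3–2.4, (2.13)–(2.15), Lemma 2.7 (ii), Thm. 1, §3 (Lemma 3.1)]]
— the `N = 32` twin of the tree's `ShintaniIndefiniteStabilizersB`, `ShintaniAnisotropicOrbits`,
`ShintaniSplitStabilizers`, `ShintaniSplitOrbits`, `ShintaniSplitPeriods`,
`ShintaniLiftQExpansion`, `ShintaniLiftCoeffCanonical`, `ShintaniLiftHolomorphy` and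
`ShintaniSplitOrbitCoefficients` (`N = 64`), for the unfolded GENERIC level-`32` lift
`Φ[c,t] = √(Im z) ∑_ω J(ω)` of `ShintaniGenericNullDefinite32` (bounded `Γ₀(32)`-invariant weight
`c` on the coordinates of `L♮₃₂ = {[32a, b, c]}`, scale `t > 0`, `φ ∈ S₂(Γ₀(32))`, cusp width `32`,
`Δ(k) = k₁² - 128 k₀ k₂`).  Parts (generic lemmas of the level-`64` files are reused, not restated):

1. **Anisotropic stabilisers** (`indef_stabilizer32`; Pell automorph `(t - k₁s, -2k₂s; 64k₀s, t + k₁s)`).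
2. **Anisotropic orbits** = cycle integrals (`orbitIntegral_anisoG`).
3. **Split stabilisers are trivial** (`eq_one_of_smul_eq_of_sq32`: the rational roots `(-k₁ ∓ m₀)/(64k₀)`).
4. **Split orbits** = cusp-to-cusp integrals (`orbitIntegral_splitG`), and their periods as
   differences of modular symbols (`period_eq_cuspValue32_sub`).
5. **The expansion**: `√(Im z) J_z(ω) = coef(ω) e(t Δ(k_ω) z)` with
   `coef(ω) = c(k_ω) · (2√t)⁻¹ sgn(λ) · P(ω)` (`sqrt_im_mul_constG`, `sqrt_im_mul_orbitTermG`,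
   `hasSum_orbitTermG` — REAL frequencies `t Δ`, as needed for the transformed kernels at the cusps),
   and, when the frequencies on the support are naturals `e(ω)`, the `q`-series
   `hasSum_liftCoeffG` / **`qCoeffs_liftG`**.
6. **Consequences**: `orbCoefG_eq_of_data` (canonicity), **`mdifferentiable_liftG`**
   (holomorphy), `liftG_mem_of_cusp` (membership in `S_{3/2}(N, χ)` given the kernel's law and the
   cusp conditions), **`orbCoefG_split_explicit`**
   (`coef(ω) = (2√t)⁻¹ · c(k_ω) · ({∞,q₁}_φ - {∞,q₂}_φ)/(2πi)`).

No named facts; definitions `toSLR32`, `logMult32`, `logMultSubgroup32`, `pellAut32`,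
`anisoConstG`, `axisE32`, `cuspValue32`, `vOf32`, `orbCoefG`, `liftCoeffG`.
-/

noncomputable section

open scoped MatrixGroups ModularForm Modular Topology
open UpperHalfPlane hiding I
open Complex Filter MeasureTheory Set CongruenceSubgroup ModularGroup Real
open Literature.NumberTheory.EllipticCurves.ModularForms

namespace Literature.NumberTheory.EllipticCurves.Shintani

/-! ### The stabiliser condition in terms of `actSL` -/


/-- **`γ • k₀ = k₀ ↔ ι♮(k₀) ∘ γ = ι♮(k₀)`** (`γ ∈ Γ₀(64)⁺` as a real matrix). [folklore] -/
theorem smul_eq_iff_actSL32 (γ : Gamma0Plus 32) (k₀ : Fin 3 → ℤ) :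
    γ • k₀ = k₀ ↔ actSL ((γ : SL(2, ℤ)) : SL(2, ℝ)) (latSharp32 k₀) = latSharp32 k₀ := by
  rw [actSL_coe, actM_eq_iff_inv, ← latSharp32_smul_eq_actM]
  exact ⟨fun h ↦ by rw [h], fun h ↦ latSharp32_injective h⟩

/-! ### Bounded multiplier: bounded entries, finitely many integer elements -/

section Finite

variable {x : V} {M : SL(2, ℝ)} {lam : ℝ}


/-- **Finitely many elements of `Γ₀(64)⁺` stabilise `k₀` with multiplier in `[R⁻¹, R]`.** [folklore] -/
theorem finite_stab_multK_mem32 (k₀ : Fin 3 → ℤ) (hlam : lam ≠ 0) (hM : actSL M (latSharp32 k₀) = xyForm lam)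
    {R : ℝ} (hR : 1 ≤ R) :
    {γ : Gamma0Plus 32 | γ • k₀ = k₀ ∧ multK M ((γ : SL(2, ℤ)) : SL(2, ℝ)) ∈ Icc R⁻¹ R}.Finite := by
  -- an entrywise bound `B` and the integer box `[-N, N]`
  set B : ℝ := R * ∑ i : Fin 2, ∑ j : Fin 2,
    (|(M i 0 : ℝ) * (M⁻¹ : SL(2, ℝ)) 0 j| + |(M i 1 : ℝ) * (M⁻¹ : SL(2, ℝ)) 1 j|) with hB
  set N : ℤ := ⌈B⌉ with hN
  set f : Gamma0Plus 32 → (Fin 2 → Fin 2 → ℤ) := fun γ i j ↦ ((γ : SL(2, ℤ)) i j : ℤ) with hf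
  have hinj : Set.InjOn f {γ : Gamma0Plus 32 | γ • k₀ = k₀ ∧ multK M ((γ : SL(2, ℤ)) : SL(2, ℝ)) ∈ Icc R⁻¹ R} := by
    intro γ _ γ' _ h
    apply Subtype.ext
    ext i j
    exact congrFun (congrFun h i) j
  refine Set.Finite.of_finite_image ?_ hinj
  refine Set.Finite.subset (Set.Finite.pi (t := fun _ : Fin 2 ↦ Set.univ.pi (fun _ : Fin 2 ↦ Icc (-N) N))
    (fun _ ↦ Set.Finite.pi (fun _ ↦ Set.finite_Icc _ _))) ?_
  rintro F ⟨γ, ⟨hγ, hk⟩, rfl⟩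
  simp only [Set.mem_pi, Set.mem_univ, true_implies, Set.mem_Icc]
  intro i j
  have hg : actSL ((γ : SL(2, ℤ)) : SL(2, ℝ)) (latSharp32 k₀) = latSharp32 k₀ := (smul_eq_iff_actSL32 γ k₀).mp hγ
  have h := abs_entry_le hlam hM hR hg hk i j
  have hij : |((((γ : SL(2, ℤ)) : SL(2, ℝ)) i j : ℝ))| ≤ B := by
    refine h.trans ?_
    rw [hB]
    refine mul_le_mul_of_nonneg_left ?_ (by linarith)
    refine (Finset.single_le_sum (f := fun i ↦ ∑ j : Fin 2,
      (|(M i 0 : ℝ) * (M⁻¹ : SL(2, ℝ)) 0 j| + |(M i 1 : ℝ) * (M⁻¹ : SL(2, ℝ)) 1 j|))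
      (fun _ _ ↦ Finset.sum_nonneg fun _ _ ↦ by positivity) (Finset.mem_univ i)).trans' ?_
    exact Finset.single_le_sum (f := fun j ↦
      (|(M i 0 : ℝ) * (M⁻¹ : SL(2, ℝ)) 0 j| + |(M i 1 : ℝ) * (M⁻¹ : SL(2, ℝ)) 1 j|))
      (fun _ _ ↦ by positivity) (Finset.mem_univ j)
  have hcast : ((((γ : SL(2, ℤ)) : SL(2, ℝ)) i j : ℝ)) = (((γ : SL(2, ℤ)) i j : ℤ) : ℝ) := by
    simp [Matrix.SpecialLinearGroup.map_apply_coe]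
  rw [hcast] at hij
  have hle := abs_le.mp (hij.trans (Int.le_ceil B))
  constructor
  · have : ((-N : ℤ) : ℝ) ≤ ((γ : SL(2, ℤ)) i j : ℤ) := by push_cast; exact hle.1
    exact_mod_cast this
  · have : (((γ : SL(2, ℤ)) i j : ℤ) : ℝ) ≤ (N : ℝ) := hle.2
    exact_mod_cast this

end Finite

/-! ### The multiplier on the stabiliser: a homomorphism with discrete, hence cyclic, image -/


section Cyclic

variable (k₀ : Fin 3 → ℤ) {M : SL(2, ℝ)} {lam : ℝ}

/-- The real matrix of an element of the stabiliser. [folklore] -/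
abbrev toSLR32 (γ : stabK32 k₀) : SL(2, ℝ) := (((γ : Gamma0Plus 32) : SL(2, ℤ)) : SL(2, ℝ))

/-- Elements of the stabiliser stabilise the real form. [folklore] -/
theorem actSL_toSLR32 (γ : stabK32 k₀) : actSL (toSLR32 k₀ γ) (latSharp32 k₀) = latSharp32 k₀ :=
  (smul_eq_iff_actSL32 _ k₀).mp γ.2

/-- `toSLR32` is multiplicative. [folklore] -/
theorem toSLR_mul32 (γ γ' : stabK32 k₀) : toSLR32 k₀ (γ * γ') = toSLR32 k₀ γ * toSLR32 k₀ γ' := by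
  simp [toSLR32, map_mul]

/-- `toSLR32 1 = 1`. [folklore] -/
theorem toSLR_one32 : toSLR32 k₀ 1 = 1 := by simp [toSLR32, map_one]

/-- The logarithmic multiplier `ℓ(γ) = log κ(γ)`. [folklore] -/
def logMult32 (M : SL(2, ℝ)) (γ : stabK32 k₀) : ℝ := Real.log (multK M (toSLR32 k₀ γ))

variable (hlam : lam ≠ 0) (hM : actSL M (latSharp32 k₀) = xyForm lam)
include hlam hM

/-- `ℓ` is additive. [folklore] -/
theorem logMult_mul32 (γ γ' : stabK32 k₀) : logMult32 k₀ M (γ * γ') = logMult32 k₀ M γ + logMult32 k₀ M γ' := by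
  unfold logMult32
  rw [toSLR_mul32, multK_mul hlam hM (actSL_toSLR32 k₀ γ) (actSL_toSLR32 k₀ γ'),
    Real.log_mul (multK_pos hlam hM (actSL_toSLR32 k₀ γ)).ne' (multK_pos hlam hM (actSL_toSLR32 k₀ γ')).ne']

omit hlam hM in
/-- `ℓ(1) = 0`. [folklore] -/
theorem logMult_one32 : logMult32 k₀ M 1 = 0 := by
  unfold logMult32 multK
  rw [toSLR_one32, mul_one, inv_mul_cancel]
  simp

/-- `ℓ(γ⁻¹) = -ℓ(γ)`. [folklore] -/
theorem logMult_inv32 (γ : stabK32 k₀) : logMult32 k₀ M γ⁻¹ = -logMult32 k₀ M γ := by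
  have h := logMult_mul32 k₀ hlam hM γ⁻¹ γ
  rw [inv_mul_cancel, logMult_one32] at h
  linarith

/-- `κ = exp ℓ`. [folklore] -/
theorem exp_logMult32 (γ : stabK32 k₀) : Real.exp (logMult32 k₀ M γ) = multK M (toSLR32 k₀ γ) :=
  Real.exp_log (multK_pos hlam hM (actSL_toSLR32 k₀ γ))

/-- **`ℓ(γ) = 0 ⇒ γ = 1`** (`κ = 1 ⇒ γ = ±1`, and `-1 ∉ Γ₀(64)⁺`). [folklore] -/
theorem eq_one_of_logMult_eq_zero32 {γ : stabK32 k₀} (h : logMult32 k₀ M γ = 0) : γ = 1 := by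
  have hk : multK M (toSLR32 k₀ γ) = 1 := by rw [← exp_logMult32 k₀ hlam hM, h, Real.exp_zero]
  rcases eq_one_or_neg_one_of_multK_eq_one hlam hM (actSL_toSLR32 k₀ γ) hk with h2 | h2
  · apply Subtype.ext; apply Subtype.ext
    have : (((γ : Gamma0Plus 32) : SL(2, ℤ)) : SL(2, ℝ)) = ((1 : SL(2, ℤ)) : SL(2, ℝ)) := by
      rw [map_one]; exact h2
    exact eq_of_coe_real_eq this
  · exfalso
    have hneg : ((γ : Gamma0Plus 32) : SL(2, ℤ)) = -1 := eq_neg_one_of_coe_real h2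
    have hmem := (γ : Gamma0Plus 32).2
    rw [hneg] at hmem
    exact neg_one_not_mem_Gamma0Plus hmem

/-- **`ℓ` is injective.** [folklore] -/
theorem logMult_injective32 : Function.Injective (logMult32 k₀ M) := by
  intro γ γ' h
  have h1 : logMult32 k₀ M (γ * γ'⁻¹) = 0 := by
    rw [logMult_mul32 k₀ hlam hM, logMult_inv32 k₀ hlam hM, h]; ring
  have := eq_one_of_logMult_eq_zero32 k₀ hlam hM h1
  exact mul_inv_eq_one.mp this

/-- The image `L = ℓ(Γ_{k₀}) ⊆ ℝ` as an additive subgroup. [folklore] -/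
def logMultSubgroup32 (M : SL(2, ℝ)) (hlam : lam ≠ 0) (hM : actSL M (latSharp32 k₀) = xyForm lam) : AddSubgroup ℝ where
  carrier := Set.range (logMult32 k₀ M)
  zero_mem' := ⟨1, logMult_one32 k₀⟩
  add_mem' := by
    rintro _ _ ⟨γ, rfl⟩ ⟨γ', rfl⟩
    exact ⟨γ * γ', logMult_mul32 k₀ hlam hM γ γ'⟩
  neg_mem' := by
    rintro _ ⟨γ, rfl⟩
    exact ⟨γ⁻¹, logMult_inv32 k₀ hlam hM γ⟩

/-- **Discreteness**: for every `R ≥ 1` only finitely many `γ` have `|ℓ(γ)| ≤ log R`. [folklore] -/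
theorem finite_abs_logMult_le32 {R : ℝ} (hR : 1 ≤ R) : {γ : stabK32 k₀ | |logMult32 k₀ M γ| ≤ Real.log R}.Finite := by
  have hfin := finite_stab_multK_mem32 k₀ hlam hM hR
  -- `|log κ| ≤ log R ↔ κ ∈ [R⁻¹, R]`
  have hsub : (fun γ : stabK32 k₀ ↦ (γ : Gamma0Plus 32)) '' {γ : stabK32 k₀ | |logMult32 k₀ M γ| ≤ Real.log R} ⊆
      {γ : Gamma0Plus 32 | γ • k₀ = k₀ ∧ multK M ((γ : SL(2, ℤ)) : SL(2, ℝ)) ∈ Icc R⁻¹ R} := by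
    rintro _ ⟨γ, hγ, rfl⟩
    refine ⟨γ.2, ?_⟩
    have hpos := multK_pos hlam hM (actSL_toSLR32 k₀ γ)
    have hR0 : 0 < R := by linarith
    simp only [Set.mem_setOf_eq, logMult32, abs_le] at hγ
    constructor
    · have h1 : Real.log R⁻¹ ≤ Real.log (multK M (toSLR32 k₀ γ)) := by rw [Real.log_inv]; exact hγ.1
      exact (Real.log_le_log_iff (by positivity) hpos).mp h1
    · exact (Real.log_le_log_iff hpos hR0).mp hγ.2
  exact Set.Finite.of_finite_image (hfin.subset hsub) (Subtype.val_injective.injOn)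

/-- The elements of `L = ℓ(Γ_{k₀})` in `(0, log 2]` are finite in number. [folklore] -/
theorem finite_logMultSubgroup32_pos_le :
    {r : ℝ | r ∈ logMultSubgroup32 k₀ M hlam hM ∧ 0 < r ∧ r ≤ Real.log 2}.Finite := by
  have hfin := finite_abs_logMult_le32 k₀ hlam hM (by norm_num : (1 : ℝ) ≤ 2)
  have : {r : ℝ | r ∈ logMultSubgroup32 k₀ M hlam hM ∧ 0 < r ∧ r ≤ Real.log 2} ⊆
      (logMult32 k₀ M) '' {γ : stabK32 k₀ | |logMult32 k₀ M γ| ≤ Real.log 2} := by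
    rintro r ⟨⟨γ, rfl⟩, h0, h2⟩
    exact ⟨γ, abs_le.mpr ⟨by linarith, h2⟩, rfl⟩
  exact (hfin.image _).subset this

end Cyclic

/-- **A subgroup of `ℝ` with finitely many elements in some `(0, c]` is cyclic**: `L = ℤ r₀` for some
`r₀ ≥ 0` (`r₀ = 0` iff `L` is trivial). [folklore] -/
theorem _root_.AddSubgroup.exists_eq_range_of_finite_pos_le (L : AddSubgroup ℝ) {c : ℝ} (hc : 0 < c)
    (hfin : {r : ℝ | r ∈ L ∧ 0 < r ∧ r ≤ c}.Finite) :
    ∃ r₀ : ℝ, 0 ≤ r₀ ∧ (L : Set ℝ) = Set.range (fun n : ℤ ↦ n * r₀) := by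
  by_cases hbot : L = ⊥
  · refine ⟨0, le_rfl, ?_⟩
    rw [hbot]
    ext r; simp
  · set P : Set ℝ := {r : ℝ | r ∈ L ∧ 0 < r ∧ r ≤ c} with hP
    obtain ⟨a, ha0, hdisj⟩ : ∃ a : ℝ, 0 < a ∧ Disjoint (L : Set ℝ) (Ioo 0 a) := by
      by_cases hPne : P.Nonempty
      · set a := hfin.toFinset.min' ((Set.Finite.toFinset_nonempty hfin).mpr hPne) with ha
        have haP : a ∈ P := by
          have := Finset.min'_mem hfin.toFinset ((Set.Finite.toFinset_nonempty hfin).mpr hPne)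
          rwa [Set.Finite.mem_toFinset] at this
        refine ⟨a, haP.2.1, Set.disjoint_left.mpr fun r hr hra ↦ ?_⟩
        have hrP : r ∈ P := ⟨hr, hra.1, hra.2.le.trans haP.2.2⟩
        have : a ≤ r := Finset.min'_le _ _ ((Set.Finite.mem_toFinset hfin).mpr hrP)
        linarith [hra.2]
      · refine ⟨c, hc, Set.disjoint_left.mpr fun r hr hra ↦ ?_⟩
        exact hPne ⟨r, hr, hra.1, hra.2.le⟩
    obtain ⟨b, hb⟩ := AddSubgroup.exists_isLeast_pos hbot ha0 hdisj
    have hcyc := AddSubgroup.cyclic_of_min hb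
    refine ⟨b, hb.1.2.le, ?_⟩
    rw [hcyc, ← AddSubgroup.zmultiples_eq_closure]
    ext r
    simp only [SetLike.mem_coe, AddSubgroup.mem_zmultiples_iff, Set.mem_range, zsmul_eq_mul]


/-! ### Non-triviality of the stabiliser: the Pell automorph -/

/-- **The Pell automorph** of `ι♮₃₂(k₀) = (32k₀, k₁, k₂)` attached to `t² - Δ s² = 1`:
`P = (t - k₁ s, -2 k₂ s; 64 k₀ s, t + k₁ s) ∈ Γ₀(32)`. [folklore] -/
def pellAut32 (k₀ : Fin 3 → ℤ) (t s : ℤ) (h : t ^ 2 - discK k₀ * s ^ 2 = 1) : SL(2, ℤ) :=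
  ⟨!![t - k₀ 1 * s, -2 * k₀ 2 * s; 64 * k₀ 0 * s, t + k₀ 1 * s], by
    rw [Matrix.det_fin_two_of]
    rw [discK] at h
    linear_combination h⟩

/-- The Pell automorph stabilises the form. [folklore] -/
theorem actM_pellAut32 (k₀ : Fin 3 → ℤ) (t s : ℤ) (h : t ^ 2 - discK k₀ * s ^ 2 = 1) :
    actM (pellAut32 k₀ t s h) (latSharp32 k₀) = latSharp32 k₀ := by
  rw [discK] at h
  have hR : (t : ℝ) ^ 2 - ((k₀ 1 : ℝ) ^ 2 - 128 * k₀ 0 * k₀ 2) * s ^ 2 = 1 := by exact_mod_cast h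
  unfold actM pellAut32
  ext i
  fin_cases i
  · simp [actV, latSharp32]; linear_combination (32 * (k₀ 0 : ℝ)) * hR
  · simp [actV, latSharp32]; linear_combination ((k₀ 1 : ℝ)) * hR
  · simp [actV, latSharp32]; linear_combination ((k₀ 2 : ℝ)) * hR

/-- The Pell automorph lies in `Γ₀(32)`. [folklore] -/
theorem pellAut_mem_Gamma032 (k₀ : Fin 3 → ℤ) (t s : ℤ) (h : t ^ 2 - discK k₀ * s ^ 2 = 1) :
    pellAut32 k₀ t s h ∈ Gamma0 32 := by
  rw [Gamma0_mem]
  show (((64 * k₀ 0 * s : ℤ)) : ZMod 32) = 0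
  rw [show (64 * k₀ 0 * s : ℤ) = 32 * (2 * k₀ 0 * s) by ring, Int.cast_mul,
    show ((32 : ℤ) : ZMod 32) = 0 from rfl, zero_mul]


section Package

variable (k₀ : Fin 3 → ℤ) {M : SL(2, ℝ)} {lam : ℝ} (hlam : lam ≠ 0) (hM : actSL M (latSharp32 k₀) = xyForm lam)
include hlam hM

/-- The multiplier of powers: `κ(P^n) = κ(P)^n` for stabilising `P`. [folklore] -/
theorem multK_pow32 {P : SL(2, ℝ)} (hP : actSL P (latSharp32 k₀) = latSharp32 k₀) (n : ℕ) :
    multK M (P ^ n) = multK M P ^ n := by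
  induction n with
  | zero =>
    rw [pow_zero, pow_zero]
    unfold multK; rw [mul_one, inv_mul_cancel]; simp
  | succ m ih =>
    have hPm : actSL (P ^ m) (latSharp32 k₀) = latSharp32 k₀ := by
      clear ih
      induction m with
      | zero => rw [pow_zero, actSL_one]
      | succ j ihj => rw [pow_succ, ← actSL_mul, ihj, hP]
    rw [pow_succ, multK_mul hlam hM hPm hP, ih, pow_succ]

/-- **The stabiliser is non-trivial when `Δ` is not a square** (the Pell automorph, raised to a
power lying in `Γ₀(64)⁺`). [folklore] -/
theorem exists_logMult_ne_zero32 (hpos : 0 < discK k₀) (hnsq : ¬ IsSquare (discK k₀)) :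
    ∃ γ : stabK32 k₀, logMult32 k₀ M γ ≠ 0 := by
  obtain ⟨t, s, hts, hs⟩ := Pell.exists_of_not_isSquare hpos hnsq
  set P : SL(2, ℤ) := pellAut32 k₀ t s hts with hPdef
  have hPx : actM P (latSharp32 k₀) = latSharp32 k₀ := actM_pellAut32 k₀ t s hts
  -- a power in `Γ₀(64)⁺`
  have hidx : (Gamma0Plus 32).index ≠ 0 := Subgroup.FiniteIndex.index_ne_zero
  obtain ⟨n, hn, -, hmem⟩ := Subgroup.exists_pow_mem_of_index_ne_zero hidx P
  have hfix : (⟨P ^ n, hmem⟩ : Gamma0Plus 32) • k₀ = k₀ := by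
    rw [smul_eq_iff_actSL32, Subgroup.coe_mk, actSL_coe]
    exact actM_pow hPx n
  refine ⟨⟨⟨P ^ n, hmem⟩, hfix⟩, fun h0 ↦ ?_⟩
  -- `κ(P^n) = κ(P)^n = 1` forces `κ(P) = 1`, i.e. `P = ±1`, impossible as `s ≠ 0`
  have hPR : actSL (P : SL(2, ℝ)) (latSharp32 k₀) = latSharp32 k₀ := by rw [actSL_coe]; exact hPx
  have hk : multK M ((P : SL(2, ℝ)) ^ n) = 1 := by
    have := exp_logMult32 k₀ hlam hM ⟨⟨P ^ n, hmem⟩, hfix⟩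
    rw [h0, Real.exp_zero] at this
    rw [← map_pow]
    exact this.symm
  rw [multK_pow32 k₀ hlam hM hPR] at hk
  have hKpos := multK_pos hlam hM hPR
  have hK1 : multK M (P : SL(2, ℝ)) = 1 := by
    have hlog : (n : ℝ) * Real.log (multK M (P : SL(2, ℝ))) = 0 := by
      rw [← Real.log_pow, hk, Real.log_one]
    have hn' : (n : ℝ) ≠ 0 := by exact_mod_cast hn.ne'
    have : Real.log (multK M (P : SL(2, ℝ))) = 0 := by
      rcases mul_eq_zero.mp hlog with h | h
      · exact absurd h hn'
      · exact h
    rw [← Real.exp_log hKpos, this, Real.exp_zero]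
  rcases eq_one_or_neg_one_of_multK_eq_one hlam hM hPR hK1 with h1 | h1
  · have hP1 : P = 1 := by
      have : (P : SL(2, ℝ)) = ((1 : SL(2, ℤ)) : SL(2, ℝ)) := by rw [map_one]; exact h1
      exact eq_of_coe_real_eq this
    have := congrArg (fun g : SL(2, ℤ) ↦ (g 1 0 : ℤ)) hP1
    simp [hPdef, pellAut32] at this
    -- `128 k₀ 0 s = 0` and then `-2 k₂ s = 0`: so `k₀ 0 = k₀ 2 = 0`... but then `Δ = k₁²` is a square
    have h01 := congrArg (fun g : SL(2, ℤ) ↦ (g 0 1 : ℤ)) hP1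
    simp [hPdef, pellAut32] at h01
    rcases this with h00 | hs0
    · rcases h01 with h02 | hs0
      · apply hnsq
        refine ⟨k₀ 1, ?_⟩
        rw [discK, h00, h02]; ring
      · exact hs hs0
    · exact hs hs0
  · have hP1 : P = -1 := eq_neg_one_of_coe_real h1
    have := congrArg (fun g : SL(2, ℤ) ↦ (g 1 0 : ℤ)) hP1
    simp [hPdef, pellAut32] at this
    have h01 := congrArg (fun g : SL(2, ℤ) ↦ (g 0 1 : ℤ)) hP1
    simp [hPdef, pellAut32] at h01
    rcases this with h00 | hs0
    · rcases h01 with h02 | hs0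
      · apply hnsq
        refine ⟨k₀ 1, ?_⟩
        rw [discK, h00, h02]; ring
      · exact hs hs0
    · exact hs hs0


end Package

/-- **The structure of the stabiliser of an anisotropic indefinite vector in `Γ₀(64)⁺`.**  For `k₀`
with `Δ(k₀) > 0` not a square there are `M ∈ SL₂(ℝ)` with `ι♮(k₀) ∘ M = λ XY` (`λ ≠ 0`), `κ₀ > 1`
and a bijection `m : Γ_{k₀} → ℤ` such that every `γ ∈ Γ_{k₀}` acts, after conjugation by `M`, as
the homothety `M⁻¹(γ w) = κ₀^{m(γ)} · M⁻¹ w`.  (So `Γ_{k₀}` is infinite cyclic, generated by a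
hyperbolic element whose axis is the geodesic joining the roots of the form.)
[cite: Shintani1975, §2, proof of Prop. 2.3 (pp. 103–104)] -/
theorem indef_stabilizer32 (k₀ : Fin 3 → ℤ) (hpos : 0 < discK k₀) (hnsq : ¬ IsSquare (discK k₀)) :
    ∃ (M : SL(2, ℝ)) (lam κ₀ : ℝ) (m : stabK32 k₀ → ℤ), lam ≠ 0 ∧ 1 < κ₀ ∧
      actSL M (latSharp32 k₀) = xyForm lam ∧ Function.Bijective m ∧
      ∀ (γ : stabK32 k₀) (w : ℍ),
        (((M⁻¹ • ((((γ : Gamma0Plus 32) : SL(2, ℤ))) • w) : ℍ)) : ℂ) =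
          ((κ₀ ^ (m γ) : ℝ) : ℂ) * (((M⁻¹ • w : ℍ)) : ℂ) := by
  have hposR : 0 < disc (latSharp32 k₀) := by rw [disc_latSharp32_eq_discK]; exact_mod_cast hpos
  obtain ⟨a, b, c, d, lam, hdet, hlam, hconj⟩ := exists_conj_to_xyForm hposR
  set M : SL(2, ℝ) := slOf a b c d hdet with hMdef
  have hM : actSL M (latSharp32 k₀) = xyForm lam := by rw [hMdef, actSL_slOf]; exact hconj
  -- the generator of the image of `ℓ`
  obtain ⟨r₀, hr₀, hL⟩ := (logMultSubgroup32 k₀ M hlam hM).exists_eq_range_of_finite_pos_le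
    (Real.log_pos (by norm_num : (1 : ℝ) < 2)) (finite_logMultSubgroup32_pos_le k₀ hlam hM)
  have hr₀pos : 0 < r₀ := by
    rcases lt_or_eq_of_le hr₀ with h | h
    · exact h
    · exfalso
      obtain ⟨γ, hγ⟩ := exists_logMult_ne_zero32 k₀ hlam hM hpos hnsq
      have hmem : logMult32 k₀ M γ ∈ (logMultSubgroup32 k₀ M hlam hM : Set ℝ) := ⟨γ, rfl⟩
      rw [hL, ← h] at hmem
      obtain ⟨n, hn⟩ := hmem
      simp at hn
      exact hγ hn.symm
  -- `m γ`: the integer with `ℓ(γ) = m γ · r₀`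
  have hex : ∀ γ : stabK32 k₀, ∃ n : ℤ, (n : ℝ) * r₀ = logMult32 k₀ M γ := by
    intro γ
    have hmem : logMult32 k₀ M γ ∈ (logMultSubgroup32 k₀ M hlam hM : Set ℝ) := ⟨γ, rfl⟩
    rw [hL] at hmem
    exact hmem
  choose m hm using hex
  refine ⟨M, lam, Real.exp r₀, m, hlam, by simpa using hr₀pos, hM, ⟨?_, ?_⟩, ?_⟩
  · intro γ γ' h
    apply logMult_injective32 k₀ hlam hM
    rw [← hm γ, ← hm γ', h]
  · intro n
    have hmem : (n : ℝ) * r₀ ∈ (logMultSubgroup32 k₀ M hlam hM : Set ℝ) := by rw [hL]; exact ⟨n, rfl⟩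
    obtain ⟨γ, hγ⟩ := hmem
    refine ⟨γ, ?_⟩
    have := hm γ
    rw [hγ] at this
    have h2 : ((m γ : ℤ) : ℝ) = n := mul_right_cancel₀ hr₀pos.ne' this
    exact_mod_cast h2
  · intro γ w
    have h := coe_inv_smul_smul hlam hM (actSL_toSLR32 k₀ γ) w
    rw [show ((((γ : Gamma0Plus 32) : SL(2, ℤ))) • w) = (toSLR32 k₀ γ) • w from rfl, h,
      ← exp_logMult32 k₀ hlam hM γ, ← hm γ, ← Real.rpow_intCast, ← Real.exp_mul, mul_comm ((m γ : ℤ) : ℝ) r₀]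

end Literature.NumberTheory.EllipticCurves.Shintani

noncomputable section

open scoped MatrixGroups ModularForm Modular Topology ENNReal Pointwise Manifold
open UpperHalfPlane hiding I
open Complex Filter MeasureTheory Set CongruenceSubgroup ModularGroup Real MulAction
open Literature.NumberTheory.EllipticCurves.ModularForms

namespace Literature.NumberTheory.EllipticCurves.Shintani

/-! ### `SL₂(ℝ)` acting on `ℍ`: coordinates, measure, transport of the kernel terms -/

-- `coe_sl_smul` (the coordinate of `M • w`) is `ShintaniFormEquivariance.coe_sl_smul`.


/-! ### The unit semicircle is null; the two annuli agree a.e. -/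


/-! ### The transported cusp form `ψ₁ = φ|M` and the term on `M • u` -/

variable (cw : (Fin 3 → ℤ) → ℂ) (tS : ℝ) (htS : 0 < tS)


/-- The constant `K = c_D(k₀) λ e(λ² Z)`. [folklore] -/
def anisoConstG (z : ℍ) (k₀ : Fin 3 → ℤ) (lam : ℝ) : ℂ :=
  cw k₀ * ((lam : ℂ) * cexp (2 * π * I * (lam ^ 2 : ℝ) * (mulPos tS htS z : ℂ)))


/-- **The term on `M • u`** when `ι♮(k₀) ∘ M = λXY`:
`term(k₀)(Mu) = (φ|M)(u) K · u · e^{-4π Im Z λ² (Re u/Im u)²}`. [folklore] -/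
theorem liftTermG_sl_smul (f : ℍ → ℂ) (z : ℍ) {k₀ : Fin 3 → ℤ} {M : SL(2, ℝ)} {lam : ℝ}
    (hM : actSL M (latSharp32 k₀) = xyForm lam) (u : ℍ) :
    liftTermG cw tS htS f z k₀ (M • u) = (slashSL f M u * anisoConstG cw tS htS z k₀ lam) * (u : ℂ) *
      (Real.exp (-(4 * π * (mulPos tS htS z : ℂ).im * lam ^ 2) * ((u : ℂ).re / (u : ℂ).im) ^ 2) : ℂ) := by
  have hj := sl_denom_ne_zero_real M u
  have h1 := shintaniFn_actSL M u (mulPos tS htS z) (latSharp32 k₀)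
  rw [hM, shintaniFn_xyForm] at h1
  have h2 : shintaniFn (M • u) (mulPos tS htS z) (latSharp32 k₀) =
      ((lam : ℂ) * cexp (2 * π * I * (lam ^ 2 : ℝ) * (mulPos tS htS z : ℂ))) * (u : ℂ) *
        (Real.exp (-(4 * π * (mulPos tS htS z : ℂ).im * lam ^ 2) * ((u : ℂ).re / (u : ℂ).im) ^ 2) : ℂ) /
        (((M 1 0 : ℝ) : ℂ) * u + ((M 1 1 : ℝ) : ℂ)) ^ 2 := by
    rw [eq_div_iff (pow_ne_zero 2 hj), mul_comm, ← h1]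
  rw [liftTermG, h2, slashSL, anisoConstG, UpperHalfPlane.ofComplex_apply]
  field_simp

/-- `(φ|M) K` at `κ u` relates to `u`: the invariance under the generator of the stabiliser.
With `M⁻¹(γ₁ w) = κ₀ · M⁻¹ w` and `term(k₀)` `Γ_{k₀}`-invariant,
`(φ|M)(κ₀ u) κ₀ = (φ|M)(u)` (times `K`). [folklore] -/
theorem slashSL_mul_invG {cw : (Fin 3 → ℤ) → ℂ} (hinv : InvWeight32 cw) (tS : ℝ) (htS : 0 < tS)
    (f : CuspForm (Gamma0 32) 2) (z : ℍ) {k₀ : Fin 3 → ℤ}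
    {M : SL(2, ℝ)} {lam κ₀ : ℝ} (hκ : 1 < κ₀) (hM : actSL M (latSharp32 k₀) = xyForm lam)
    {γ₁ : stabK32 k₀} (hγ₁ : ∀ w : ℍ, (((M⁻¹ • (((γ₁ : Gamma0Plus 32) : SL(2, ℤ)) • w) : ℍ)) : ℂ) =
      ((κ₀ : ℝ) : ℂ) * (((M⁻¹ • w : ℍ)) : ℂ)) {w : ℂ} (hw : 0 < w.im) :
    slashSL f M (((κ₀ / 1 : ℝ)) * w) * anisoConstG cw tS htS z k₀ lam * ((κ₀ / 1 : ℝ)) =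
      slashSL f M w * anisoConstG cw tS htS z k₀ lam := by
  have hκ0 : 0 < κ₀ := by linarith
  set u : ℍ := ⟨w, hw⟩ with hu
  set u' : ℍ := mulPos κ₀ hκ0 u with hu'
  -- `γ₁ • (M • u) = M • u'`
  have hpt : (((γ₁ : Gamma0Plus 32) : SL(2, ℤ))) • (M • u) = M • u' := by
    have h1 : M⁻¹ • ((((γ₁ : Gamma0Plus 32) : SL(2, ℤ))) • (M • u)) = u' := by
      apply UpperHalfPlane.ext
      rw [hγ₁ (M • u), inv_smul_smul, hu', coe_mulPos]
    calc (((γ₁ : Gamma0Plus 32) : SL(2, ℤ))) • (M • u)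
        = M • (M⁻¹ • ((((γ₁ : Gamma0Plus 32) : SL(2, ℤ))) • (M • u))) := by rw [smul_inv_smul]
      _ = M • u' := by rw [h1]
  have hstab := liftTermG_stab_invariant hinv tS htS f z k₀ γ₁ (M • u)
  have hinv' : liftTermG cw tS htS f z k₀ (M • u') = liftTermG cw tS htS f z k₀ (M • u) := by
    rw [← hpt]; exact hstab
  rw [liftTermG_sl_smul cw tS htS f z hM, liftTermG_sl_smul cw tS htS f z hM] at hinv'
  -- the Gaussian factors agree (`Re/Im` is scale invariant) and `u' = κ₀ u`
  have hratio : ((u' : ℂ).re / (u' : ℂ).im) = ((u : ℂ).re / (u : ℂ).im) := by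
    rw [hu', mulPos_re, mulPos_im, mul_div_mul_left _ _ hκ0.ne']
  rw [hratio] at hinv'
  have hu'c : ((u' : ℍ) : ℂ) = ((κ₀ : ℝ) : ℂ) * (u : ℂ) := by rw [hu', coe_mulPos]
  rw [hu'c] at hinv'
  have hG : (Real.exp (-(4 * π * (mulPos tS htS z : ℂ).im * lam ^ 2) * ((u : ℂ).re / (u : ℂ).im) ^ 2) : ℂ) ≠ 0 :=
    Complex.ofReal_ne_zero.mpr (Real.exp_pos _).ne'
  have hu0 : (u : ℂ) ≠ 0 := UpperHalfPlane.ne_zero u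
  have huw : (u : ℂ) = w := rfl
  rw [div_one, huw] at *
  -- cancel `u · G`
  have := mul_right_cancel₀ hG hinv'
  have h3 : slashSL f M (((κ₀ : ℝ) : ℂ) * w) * anisoConstG cw tS htS z k₀ lam * ((κ₀ : ℝ) : ℂ) * w =
      slashSL f M w * anisoConstG cw tS htS z k₀ lam * w := by
    calc slashSL f M (((κ₀ : ℝ) : ℂ) * w) * anisoConstG cw tS htS z k₀ lam * ((κ₀ : ℝ) : ℂ) * w
        = slashSL f M (((κ₀ : ℝ) : ℂ) * w) * anisoConstG cw tS htS z k₀ lam * (((κ₀ : ℝ) : ℂ) * w) := by ring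
      _ = slashSL f M w * anisoConstG cw tS htS z k₀ lam * w := this
  exact mul_right_cancel₀ (by rw [← huw]; exact hu0) h3

/-! ### Holomorphy and the invariant bound of `φ|M` -/


/-- **`φ|M` is holomorphic on `Im > 0`** for a cusp form `φ`. [folklore] -/
theorem differentiableOn_slashSL32 (f : CuspForm (Gamma0 32) 2) (M : SL(2, ℝ)) :
    DifferentiableOn ℂ (slashSL f M) {τ : ℂ | 0 < τ.im} := by
  have hf : DifferentiableOn ℂ (⇑f ∘ UpperHalfPlane.ofComplex) {τ : ℂ | 0 < τ.im} :=
    UpperHalfPlane.mdifferentiable_iff.mp (CuspFormClass.holo f)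
  set moeb : ℂ → ℂ := fun τ ↦ (((M 0 0 : ℝ) : ℂ) * τ + ((M 0 1 : ℝ) : ℂ)) / (((M 1 0 : ℝ) : ℂ) * τ + ((M 1 1 : ℝ) : ℂ))
    with hmoeb
  have hm : DifferentiableOn ℂ moeb {τ : ℂ | 0 < τ.im} := by
    intro τ hτ
    refine DifferentiableAt.differentiableWithinAt ?_
    exact ((differentiableAt_const _).mul differentiableAt_id |>.add (differentiableAt_const _)).div
      ((differentiableAt_const _).mul differentiableAt_id |>.add (differentiableAt_const _)) (moeb_denom_ne_zero' M hτ)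
  have hmaps : MapsTo moeb {τ : ℂ | 0 < τ.im} {τ : ℂ | 0 < τ.im} := fun τ hτ ↦ moeb_im_pos M hτ
  have hcomp := hf.comp hm hmaps
  have hden : DifferentiableOn ℂ (fun τ : ℂ ↦ ((((M 1 0 : ℝ) : ℂ) * τ + ((M 1 1 : ℝ) : ℂ)) ^ 2)⁻¹) {τ : ℂ | 0 < τ.im} := by
    intro τ hτ
    refine DifferentiableAt.differentiableWithinAt ?_
    refine (((differentiableAt_const _).mul differentiableAt_id |>.add (differentiableAt_const _)).pow 2).inv ?_
    exact pow_ne_zero 2 (moeb_denom_ne_zero' M hτ)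
  refine (hcomp.mul hden).congr fun τ hτ ↦ ?_
  simp only [slashSL, Pi.mul_apply, Function.comp_apply, hmoeb]
  rw [sl_smul_ofComplex M hτ]

/-- **The invariant bound**: `‖(φ|M)(w)‖ Im w ≤ C₀` where `‖φ(τ)‖ Im τ ≤ C₀`. [folklore] -/
theorem norm_slashSL_mul_im_le32 (f : CuspForm (Gamma0 32) 2) (M : SL(2, ℝ)) {C₀ : ℝ}
    (hC₀ : ∀ τ : ℍ, ‖f τ‖ * τ.im ≤ C₀) {w : ℂ} (hw : 0 < w.im) :
    ‖slashSL f M w‖ * w.im ≤ C₀ := by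
  set u : ℍ := ⟨w, hw⟩
  have hu : UpperHalfPlane.ofComplex w = u := by
    apply UpperHalfPlane.ext; rw [UpperHalfPlane.ofComplex_apply_of_im_pos hw]
  have hj := sl_denom_ne_zero_real M u
  have him := sl_smul_im M u
  have hns : Complex.normSq (((M 1 0 : ℝ) : ℂ) * u + ((M 1 1 : ℝ) : ℂ)) =
      ‖((M 1 0 : ℝ) : ℂ) * u + ((M 1 1 : ℝ) : ℂ)‖ ^ 2 := Complex.normSq_eq_norm_sq _
  have h := hC₀ (M • u)
  rw [him, hns] at h
  rw [slashSL, hu, norm_mul, norm_inv, norm_pow]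
  have huw : (u : ℂ) = w := rfl
  have hwim : w.im = u.im := rfl
  rw [huw] at *
  rw [hwim]
  have hpos : 0 < ‖((M 1 0 : ℝ) : ℂ) * w + ((M 1 1 : ℝ) : ℂ)‖ ^ 2 := by positivity
  calc ‖f (M • u)‖ * (‖((M 1 0 : ℝ) : ℂ) * w + ((M 1 1 : ℝ) : ℂ)‖ ^ 2)⁻¹ * u.im
      = ‖f (M • u)‖ * (u.im / ‖((M 1 0 : ℝ) : ℂ) * w + ((M 1 1 : ℝ) : ℂ)‖ ^ 2) := by
        field_simp
    _ ≤ C₀ := h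


/-! ### The anisotropic orbit integral -/


/-- **The orbit integral of an anisotropic indefinite vector** (`c` invariant and bounded, `φ ∈ S₂(Γ₀(32))`): for
`ω` with `Δ(k_ω) > 0` not a square there are `M ∈ SL₂(ℝ)` with `ι♮(k_ω) ∘ M = λ XY`, and the
multiplier `κ₀ > 1` of a generator of `Γ_{k_ω}`, such that
`J(ω) = c_D(k_ω) λ e(λ² Z) · (∫₁^{κ₀} (φ|M)(iy) i dy) · √(π/(4π Im Z λ²))` — Shintani's evaluation
(2.13)–(2.14) of the orbit integral as a CYCLE INTEGRAL of `φ` over the closed geodesic of the form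
(the transverse Gaussian integrates to `√(π/c)`, `ShintaniOrbitIntegrals`).
[cite: Shintani1975, §2, Prop. 2.3, (2.13)–(2.14)] -/
theorem orbitIntegral_anisoG {cw : (Fin 3 → ℤ) → ℂ} (hinv : InvWeight32 cw) (tS : ℝ) (htS : 0 < tS)
    (f : CuspForm (Gamma0 32) 2) (z : ℍ)
    (ω : orbitRel.Quotient (Gamma0Plus 32) (Fin 3 → ℤ)) (hpos : 0 < discK ω.out)
    (hnsq : ¬ IsSquare (discK ω.out)) :
    ∃ (M : SL(2, ℝ)) (lam κ₀ : ℝ), lam ≠ 0 ∧ 1 < κ₀ ∧ actSL M (latSharp32 ω.out) = xyForm lam ∧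
      orbitIntegralG cw tS htS f z ω = anisoConstG cw tS htS z ω.out lam *
        rayIntegral (slashSL f M) (π / 2) 1 κ₀ *
          (Real.sqrt (π / (4 * π * (mulPos tS htS z : ℂ).im * lam ^ 2)) : ℝ) := by
  set k₀ := ω.out with hk₀
  obtain ⟨M, lam, κ₀, m, hlam, hκ, hM, hm, hact⟩ := indef_stabilizer32 k₀ hpos hnsq
  refine ⟨M, lam, κ₀, hlam, hκ, hM, ?_⟩
  have hκ0 : 0 < κ₀ := by linarith
  -- the two fundamental domains of `Γ_{k₀}`
  have hFD := isFundamentalDomain_orbitDomain32 k₀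
  have hFD' : IsFundamentalDomain (stabK32 k₀) (M • hannulus κ₀) (volume : Measure ℍ) :=
    isFundamentalDomain_conj_hannulus M hκ m hm (fun γ w ↦ hact γ w)
  have hstab : ∀ (γ : stabK32 k₀) (w : ℍ), liftTermG cw tS htS f z k₀ (γ • w) = liftTermG cw tS htS f z k₀ w :=
    liftTermG_stab_invariant hinv tS htS f z k₀
  unfold orbitIntegralG
  rw [← hk₀, hFD.setIntegral_eq hFD' hstab, setIntegral_sl_smul_set_real,
    setIntegral_congr_set (hannulus_ae_eq_Ioo κ₀)]
  simp_rw [liftTermG_sl_smul cw tS htS f z hM]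
  -- the sibling's evaluation
  obtain ⟨C₀, -, hC₀⟩ := exists_norm_mul_im_le f
  obtain ⟨γ₁, hγ₁⟩ := hm.2 1
  have hgen : ∀ w : ℍ, (((M⁻¹ • (((γ₁ : Gamma0Plus 32) : SL(2, ℤ)) • w) : ℍ)) : ℂ) =
      ((κ₀ : ℝ) : ℂ) * (((M⁻¹ • w : ℍ)) : ℂ) := by
    intro w; rw [hact γ₁ w, hγ₁, zpow_one]
  have hc : 0 < 4 * π * (mulPos tS htS z : ℂ).im * lam ^ 2 := by
    have h1 : 0 < (mulPos tS htS z : ℂ).im := by rw [UpperHalfPlane.coe_im]; exact (mulPos tS htS z).im_pos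
    have h2 : 0 < lam ^ 2 := by positivity
    positivity
  have hCψ : ∀ w : ℂ, 0 < w.im → ‖slashSL f M w * anisoConstG cw tS htS z k₀ lam‖ * w.im ≤ C₀ * ‖anisoConstG cw tS htS z k₀ lam‖ := by
    intro w hw
    calc ‖slashSL f M w * anisoConstG cw tS htS z k₀ lam‖ * w.im
        = (‖slashSL f M w‖ * w.im) * ‖anisoConstG cw tS htS z k₀ lam‖ := by rw [norm_mul]; ring
      _ ≤ C₀ * ‖anisoConstG cw tS htS z k₀ lam‖ :=
        mul_le_mul_of_nonneg_right (norm_slashSL_mul_im_le32 f M hC₀ hw) (norm_nonneg _)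
  have key := setIntegral_upperHalfPlane_annulus_eq (ψ := fun τ ↦ slashSL f M τ * anisoConstG cw tS htS z k₀ lam)
    (c := 4 * π * (mulPos tS htS z : ℂ).im * lam ^ 2) (C := C₀ * ‖anisoConstG cw tS htS z k₀ lam‖) (r₁ := 1) (r₂ := κ₀)
    ((differentiableOn_slashSL32 f M).mul_const _) hCψ hc one_pos hκ.le
    (fun w hw ↦ slashSL_mul_invG hinv tS htS f z hκ hM hgen hw)
  rw [rayIntegral_mul_const] at key
  rw [← key]

end Literature.NumberTheory.EllipticCurves.Shintani

noncomputable section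

open scoped MatrixGroups
open UpperHalfPlane hiding I
open Complex CongruenceSubgroup ModularGroup Real
open Literature.NumberTheory.EllipticCurves.ModularForms

namespace Literature.NumberTheory.EllipticCurves.Shintani

/-! ### An element of `SL₂(ℤ)` with two distinct rational fixed points is `±1` -/


/-! ### Split vectors: the columns of the conjugating matrix point to the rational roots -/


/-- **The stabiliser of a split vector is trivial**: for `k₀` with `Δ(k₀) = m₀²`, `m₀ > 0`,
every `γ ∈ Γ₀(64)⁺` with `γ • k₀ = k₀` is `1`. [cite: Shintani1975, §2, proof of Prop. 2.3] -/
theorem eq_one_of_smul_eq_of_sq32 {k₀ : Fin 3 → ℤ} {m₀ : ℤ} (hm₀ : 0 < m₀) (hΔ : discK k₀ = m₀ ^ 2)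
    {γ : Gamma0Plus 32} (hγ : γ • k₀ = k₀) : γ = 1 := by
  set x : V := latSharp32 k₀ with hxdef
  have hdiscR : disc x = ((m₀ : ℝ)) ^ 2 := by
    rw [disc_latSharp32_eq_discK, hΔ]; push_cast; ring
  have hpos : 0 < disc x := by
    rw [hdiscR]; exact pow_pos (by exact_mod_cast hm₀) 2
  have hsqrt : Real.sqrt (disc x) = m₀ := by
    rw [hdiscR, Real.sqrt_sq (by exact_mod_cast hm₀.le)]
  have hg : actSL (((γ : SL(2, ℤ))) : SL(2, ℝ)) x = x := (smul_eq_iff_actSL32 γ k₀).mp hγ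
  set g : SL(2, ℤ) := (γ : SL(2, ℤ)) with hgdef
  -- the rational conclusion `g = ±1` gives `γ = 1`
  suffices hpm : g = 1 ∨ g = -1 by
    rcases hpm with h1 | h1
    · exact Subtype.ext h1
    · exfalso; have hmem := γ.2; rw [← hgdef, h1] at hmem; exact neg_one_not_mem_Gamma0Plus hmem
  have hdet := det_eq_one' g
  by_cases hx0 : x 0 = 0
  · -- `x = (0, k₁, k₂)` with `k₁ ≠ 0`: `(k₁ k₂) g = (k₁ k₂)` forces `g = ±1` directly
    have hk0 : k₀ 0 = 0 := by
      have : (32 : ℝ) * (k₀ 0 : ℝ) = 0 := by rw [← latSharp32_zero]; exact hx0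
      exact_mod_cast (mul_eq_zero.mp this).resolve_left (by norm_num)
    have hk1 : k₀ 1 ≠ 0 := by
      intro h1; rw [discK, hk0, h1] at hΔ; nlinarith
    -- integer identities from `actM g x = x`
    have hgx : actM g x = x := by rw [← actSL_coe]; exact hg
    have c0 := congrFun (congrArg (fun v : V ↦ (v : Fin 3 → ℝ)) hgx) 0
    have c1 := congrFun (congrArg (fun v : V ↦ (v : Fin 3 → ℝ)) hgx) 1
    have c2 := congrFun (congrArg (fun v : V ↦ (v : Fin 3 → ℝ)) hgx) 2
    simp [actM, actV, hxdef, latSharp32, hk0] at c0 c1 c2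
    -- `r (Bp + Cr) = 0`, `B(ps+qr) + 2Crs = B`, `Bqs + Cs² = C` over `ℝ`, hence over `ℤ`
    have i0 : (g 1 0 : ℤ) * (k₀ 1 * g 0 0 + k₀ 2 * g 1 0) = 0 := by
      have : ((g 1 0 : ℤ) : ℝ) * ((k₀ 1 : ℝ) * (g 0 0 : ℤ) + (k₀ 2 : ℝ) * (g 1 0 : ℤ)) = 0 := by nlinarith [c0]
      exact_mod_cast this
    have i1 : (k₀ 1 : ℤ) * (g 0 0 * g 1 1 + g 0 1 * g 1 0) + 2 * k₀ 2 * g 1 0 * g 1 1 = k₀ 1 := by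
      have : ((k₀ 1 : ℤ) : ℝ) * ((g 0 0 : ℤ) * (g 1 1 : ℤ) + (g 0 1 : ℤ) * (g 1 0 : ℤ)) +
          2 * (k₀ 2 : ℝ) * (g 1 0 : ℤ) * (g 1 1 : ℤ) = k₀ 1 := by nlinarith [c1]
      exact_mod_cast this
    have i2 : (k₀ 1 : ℤ) * g 0 1 * g 1 1 + k₀ 2 * g 1 1 ^ 2 = k₀ 2 := by
      have : ((k₀ 1 : ℤ) : ℝ) * (g 0 1 : ℤ) * (g 1 1 : ℤ) + (k₀ 2 : ℝ) * ((g 1 1 : ℤ) : ℝ) ^ 2 = k₀ 2 := by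
        nlinarith [c2]
      exact_mod_cast this
    by_cases hr : (g 1 0 : ℤ) = 0
    · rw [hr] at hdet i1
      simp only [mul_zero, sub_zero, add_zero] at hdet i1
      rcases Int.eq_one_or_neg_one_of_mul_eq_one hdet with hp | hp
      · have hs : (g 1 1 : ℤ) = 1 := by rw [hp] at hdet; linarith
        have hq : (g 0 1 : ℤ) = 0 := by
          rw [hs] at i2; have : (k₀ 1 : ℤ) * g 0 1 = 0 := by nlinarith
          exact (mul_eq_zero.mp this).resolve_left hk1
        left; ext i j; fin_cases i <;> fin_cases j <;> simp [hp, hq, hr, hs]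
      · have hs : (g 1 1 : ℤ) = -1 := by rw [hp] at hdet; linarith
        have hq : (g 0 1 : ℤ) = 0 := by
          rw [hs] at i2; have : (k₀ 1 : ℤ) * g 0 1 = 0 := by nlinarith
          exact (mul_eq_zero.mp this).resolve_left hk1
        right; ext i j; fin_cases i <;> fin_cases j <;> simp [hp, hq, hr, hs]
    · exfalso
      have hBp : (k₀ 1 : ℤ) * g 0 0 + k₀ 2 * g 1 0 = 0 := (mul_eq_zero.mp i0).resolve_left hr
      have hBq : (k₀ 1 : ℤ) * g 0 1 + k₀ 2 * g 1 1 = 0 := by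
        have hqr : (g 0 1 : ℤ) * g 1 0 = g 0 0 * g 1 1 - 1 := by linarith
        have : 2 * (g 1 0 : ℤ) * (k₀ 1 * g 0 1 + k₀ 2 * g 1 1) = 0 := by
          linear_combination i1 + (k₀ 1 : ℤ) * hqr
        rcases mul_eq_zero.mp this with h | h
        · rcases mul_eq_zero.mp h with h' | h'
          · norm_num at h'
          · exact absurd h' hr
        · exact h
      -- `(k₁, k₂) g = 0` with `g` invertible forces `k₁ = 0`
      have : (k₀ 1 : ℤ) * (g 0 0 * g 1 1 - g 0 1 * g 1 0) = 0 := by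
        linear_combination (g 1 1 : ℤ) * hBp - (g 1 0 : ℤ) * hBq
      rw [hdet, mul_one] at this
      exact hk1 this
  · -- `x₀ ≠ 0`: the columns of the conjugating matrix are the rational roots
    obtain ⟨a, b, c, d, lam, hdet', hlam, hconj, hc0, hd0, hcol1, hcol2⟩ := exists_conj_cols hx0 hpos
    set M : SL(2, ℝ) := slOf a b c d hdet' with hMdef
    have hM : actSL M x = xyForm lam := by rw [hMdef, actSL_slOf]; exact hconj
    obtain ⟨h10, h01⟩ := (actSL_eq_iff_conj hlam hM ((g : SL(2, ℤ)) : SL(2, ℝ))).mp hg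
    have hfix := fixed_of_conj_diag (M := M) (g := ((g : SL(2, ℤ)) : SL(2, ℝ)))
      (by simpa [hMdef, slOf] using hc0) (by simpa [hMdef, slOf] using hd0) h10 h01
    have hMc : (M 0 0 : ℝ) / M 1 0 = a / c := by simp [hMdef, slOf]
    have hMd : (M 0 1 : ℝ) / M 1 1 = b / d := by simp [hMdef, slOf]
    rw [hMc, hMd, hcol1, hcol2, hsqrt] at hfix
    -- the roots as rationals
    have hx0Q : (64 * k₀ 0 : ℚ) ≠ 0 := by
      have : (32 : ℝ) * (k₀ 0 : ℝ) ≠ 0 := by rw [← latSharp32_zero]; exact hx0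
      have : (k₀ 0 : ℝ) ≠ 0 := by intro h; apply this; rw [h, mul_zero]
      have : (k₀ 0 : ℚ) ≠ 0 := by exact_mod_cast (show (k₀ 0 : ℤ) ≠ 0 by exact_mod_cast this)
      positivity
    set ξ : ℚ := (-(k₀ 1 : ℚ) - m₀) / (64 * k₀ 0) with hξ
    set et : ℚ := (-(k₀ 1 : ℚ) + m₀) / (64 * k₀ 0) with het
    have hξR : ((ξ : ℚ) : ℝ) = (-x 1 - m₀) / (2 * x 0) := by
      rw [hξ, hxdef, latSharp32_zero, latSharp32_one]; push_cast; ring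
    have hetR : ((et : ℚ) : ℝ) = (-x 1 + m₀) / (2 * x 0) := by
      rw [het, hxdef, latSharp32_zero, latSharp32_one]; push_cast; ring
    rw [← hξR, ← hetR] at hfix
    have hne : ξ ≠ et := by
      intro h
      have : (2 * m₀ : ℚ) / (64 * k₀ 0) = 0 := by
        have := congrArg (fun t : ℚ ↦ et - t) h
        simp only [sub_self] at this
        rw [← this, hξ, het]; ring
      rw [div_eq_zero_iff] at this
      rcases this with h1 | h1
      · have : (m₀ : ℚ) = 0 := by linarith
        have : m₀ = 0 := by exact_mod_cast this
        omega
      · exact hx0Q h1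
    have hcast : ∀ i j, ((((g : SL(2, ℤ)) : SL(2, ℝ)) i j : ℝ)) = (((g i j : ℤ) : ℚ) : ℝ) := by
      intro i j; rw [Rat.cast_intCast]; simp [Matrix.SpecialLinearGroup.map_apply_coe]
    rw [hcast 0 0, hcast 0 1, hcast 1 0, hcast 1 1] at hfix
    obtain ⟨hf1, hf2⟩ := hfix
    refine eq_one_or_neg_one_of_two_rat_fixed hne ?_ ?_
    · exact_mod_cast hf1
    · exact_mod_cast hf2

/-- **`Γ_{k₀} = 1` for split `k₀`.** [cite: Shintani1975, §2, proof of Prop. 2.3] -/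
theorem stabK_eq_bot_of_sq32 {k₀ : Fin 3 → ℤ} {m₀ : ℤ} (hm₀ : 0 < m₀) (hΔ : discK k₀ = m₀ ^ 2) :
    stabK32 k₀ = ⊥ := by
  rw [Subgroup.eq_bot_iff_forall]
  intro γ hγ
  exact eq_one_of_smul_eq_of_sq32 hm₀ hΔ hγ

end Literature.NumberTheory.EllipticCurves.Shintani

noncomputable section

open scoped MatrixGroups ModularForm Modular Topology ENNReal Pointwise Manifold
open UpperHalfPlane hiding I
open Complex Filter MeasureTheory Set CongruenceSubgroup ModularGroup Real MulAction Asymptotics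
open Literature.NumberTheory.EllipticCurves.ModularForms

namespace Literature.NumberTheory.EllipticCurves.Shintani

/-! ### Decay of `φ` at a cusp, seen through a real matrix fixing the direction of the cusp -/


/-- **Decay of a cusp form at a cusp, through a real matrix**: for `A ∈ SL₂(ℤ)` and upper
triangular `N ∈ SL₂(ℝ)`, `rⁿ ‖φ((A N)(r e^{iθ}))‖ → 0` as `r → ∞` (`θ ∈ (0, π)`): `A N` maps `∞`
to the cusp `A∞`, and `φ|A` decays exponentially. [folklore] -/
theorem tendsto_pow_mul_norm_cusp32 (f : CuspForm (Gamma0 32) 2) (A : SL(2, ℤ)) (Nu : SL(2, ℝ))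
    (hN : (Nu 1 0 : ℝ) = 0) {θ : ℝ} (hθ : θ ∈ Ioo 0 π) (n : ℕ) :
    Tendsto (fun r : ℝ ↦ r ^ n * ‖f ((((A : SL(2, ℤ)) : SL(2, ℝ)) * Nu) • UpperHalfPlane.ofComplex (polarPt r θ))‖)
      atTop (𝓝 0) := by
  obtain ⟨C, hC0, hC⟩ := HaberlandStokes.exists_norm_apply_le (isCuspFunction_slash f A)
  have hsin : 0 < Real.sin θ := Real.sin_pos_of_pos_of_lt_pi hθ.1 hθ.2
  have hdet := det_entries_real Nu
  rw [hN, mul_zero, sub_zero] at hdet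
  have ha0 : (Nu 0 0 : ℝ) ≠ 0 := by intro h; rw [h, zero_mul] at hdet; exact zero_ne_one hdet
  set a2 : ℝ := (Nu 0 0 : ℝ) ^ 2 with ha2
  have ha2pos : 0 < a2 := by positivity
  set κ : ℝ := 2 * Real.pi / 32 * (a2 * Real.sin θ) with hκ
  have hκpos : 0 < κ := by positivity
  -- sizes of the denominator entries of `A`
  set α : ℝ := |((A 1 0 : ℤ) : ℝ)| * a2 with hα
  set β : ℝ := |((A 1 0 : ℤ) : ℝ)| * |(Nu 0 0 : ℝ) * Nu 0 1| + |((A 1 1 : ℤ) : ℝ)| with hβ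
  have hα0 : 0 ≤ α := by positivity
  have hβ0 : 0 ≤ β := by positivity
  -- the comparison function
  have hlim : Tendsto (fun r : ℝ ↦ C * (α + β) ^ 2 * (r ^ ((n : ℝ) + 2) * Real.exp (-κ * r))) atTop (𝓝 0) := by
    have := (tendsto_rpow_mul_exp_neg_mul_atTop_nhds_zero ((n : ℝ) + 2) κ hκpos).const_mul (C * (α + β) ^ 2)
    rw [mul_zero] at this
    exact this
  refine squeeze_zero' ((eventually_ge_atTop 0).mono fun r hr ↦ by positivity) ?_ hlim
  -- the bound for large `r`
  have hR : ∀ᶠ r : ℝ in atTop, 1 ≤ r ∧ 1 / 2 < a2 * Real.sin θ * r := by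
    refine (eventually_ge_atTop (max 1 (1 / (a2 * Real.sin θ)))).mono fun r hr ↦ ⟨?_, ?_⟩
    · exact (le_max_left _ _).trans hr
    · have h1 : 1 / (a2 * Real.sin θ) ≤ r := (le_max_right _ _).trans hr
      have hpos : 0 < a2 * Real.sin θ := by positivity
      rw [div_le_iff₀ hpos] at h1
      nlinarith
  refine hR.mono fun r ⟨hr1, hr2⟩ ↦ ?_
  have hr0 : 0 < r := by linarith
  set τ : ℍ := UpperHalfPlane.ofComplex (polarPt r θ) with hτ
  have hτc : (τ : ℂ) = polarPt r θ := coe_ofComplex_polarPt hr0 hθ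
  set w : ℍ := Nu • τ with hw
  have hwc : (w : ℂ) = ((Nu 0 0 : ℝ) : ℂ) ^ 2 * polarPt r θ + ((Nu 0 0 : ℝ) : ℂ) * ((Nu 0 1 : ℝ) : ℂ) := by
    rw [hw, coe_upper_smul Nu hN, hτc]
  have hwim : (w : ℂ).im = a2 * Real.sin θ * r := by
    rw [hwc, add_im, mul_im, polarPt_im, polarPt_re]
    simp only [← Complex.ofReal_pow, Complex.ofReal_re, Complex.ofReal_im, mul_im, Complex.ofReal_re,
      Complex.ofReal_im, mul_zero, zero_mul, add_zero]
    rw [ha2]; ring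
  -- `φ(A w) = (φ|A)(w) · (c_A w + d_A)²`
  have hslash := ModularForm.SL_slash_apply (k := (2 : ℤ)) (⇑f) A w
  rw [ModularGroup.denom_apply] at hslash
  have hden : ((A 1 0 : ℤ) : ℂ) * (w : ℂ) + ((A 1 1 : ℤ) : ℂ) ≠ 0 := by
    have := UpperHalfPlane.denom_ne_zero (A : GL (Fin 2) ℝ) w
    rw [ModularGroup.denom_apply] at this
    exact this
  have hfw : f ((((A : SL(2, ℤ)) : SL(2, ℝ)) * Nu) • τ) =
      (⇑f ∣[(2 : ℤ)] A) w * (((A 1 0 : ℤ) : ℂ) * (w : ℂ) + ((A 1 1 : ℤ) : ℂ)) ^ 2 := by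
    rw [mul_smul, show (((A : SL(2, ℤ)) : SL(2, ℝ)) • (Nu • τ)) = A • w from rfl, hslash]
    field_simp
  -- the two bounds
  have hfA : ‖(⇑f ∣[(2 : ℤ)] A) w‖ ≤ C * Real.exp (-(2 * Real.pi / 32) * (w : ℂ).im) := by
    have := hC (w : ℂ) (by rw [hwim]; exact hr2)
    rwa [UpperHalfPlane.ofComplex_apply] at this
  have hdenle : ‖((A 1 0 : ℤ) : ℂ) * (w : ℂ) + ((A 1 1 : ℤ) : ℂ)‖ ≤ (α + β) * r := by
    have hwn : ‖(w : ℂ)‖ ≤ a2 * r + |(Nu 0 0 : ℝ) * Nu 0 1| := by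
      rw [hwc]
      refine (norm_add_le _ _).trans ?_
      rw [norm_mul, ← Complex.ofReal_pow, Complex.norm_real, norm_polarPt, ← Complex.ofReal_mul,
        Complex.norm_real, Real.norm_eq_abs, Real.norm_eq_abs, abs_of_pos ha2pos, abs_of_pos hr0]
    calc ‖((A 1 0 : ℤ) : ℂ) * (w : ℂ) + ((A 1 1 : ℤ) : ℂ)‖
        ≤ ‖((A 1 0 : ℤ) : ℂ)‖ * ‖(w : ℂ)‖ + ‖((A 1 1 : ℤ) : ℂ)‖ := by
          refine (norm_add_le _ _).trans ?_; rw [norm_mul]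
      _ ≤ |((A 1 0 : ℤ) : ℝ)| * (a2 * r + |(Nu 0 0 : ℝ) * Nu 0 1|) + |((A 1 1 : ℤ) : ℝ)| := by
          gcongr
          · rw [← Complex.ofReal_intCast, Complex.norm_real, Real.norm_eq_abs]
          · rw [← Complex.ofReal_intCast, Complex.norm_real, Real.norm_eq_abs]
      _ = α * r + β * 1 := by rw [hα, hβ]; ring
      _ ≤ α * r + β * r := by gcongr
      _ = (α + β) * r := by ring
  -- assemble
  rw [hfw, norm_mul, norm_pow]
  have hexp : Real.exp (-(2 * Real.pi / 32) * (w : ℂ).im) = Real.exp (-κ * r) := by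
    rw [hwim, hκ]; ring_nf
  rw [hexp] at hfA
  have hrpow : r ^ ((n : ℝ) + 2) = r ^ n * r ^ 2 := by
    rw [Real.rpow_add hr0, Real.rpow_natCast, Real.rpow_two]
  rw [hrpow]
  calc r ^ n * (‖(⇑f ∣[(2 : ℤ)] A) w‖ * ‖((A 1 0 : ℤ) : ℂ) * (w : ℂ) + ((A 1 1 : ℤ) : ℂ)‖ ^ 2)
      ≤ r ^ n * ((C * Real.exp (-κ * r)) * ((α + β) * r) ^ 2) := by
        gcongr
    _ = C * (α + β) ^ 2 * (r ^ n * r ^ 2 * Real.exp (-κ * r)) := by ring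

/-! ### Factoring `M = A N` with `A ∈ SL₂(ℤ)`, `N` upper triangular, when `M∞` is a cusp -/


/-! ### The columns of `M` are isotropic; for split `k₀` they point to cusps -/


/-- **Isotropic directions of a split form are rational**: if `Δ(k₀) = m₀² > 0` and
`x₀a² + x₁ac + x₂c² = 0` (`x = ι♮(k₀)`) then `c = 0` or `a/c ∈ ℚ`. [folklore] -/
theorem isotropic_dir_rational32 {k₀ : Fin 3 → ℤ} {m₀ : ℤ} (hm₀ : 0 < m₀) (hΔ : discK k₀ = m₀ ^ 2)
    {a c : ℝ} (hiso : latSharp32 k₀ 0 * a ^ 2 + latSharp32 k₀ 1 * a * c + latSharp32 k₀ 2 * c ^ 2 = 0) :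
    c = 0 ∨ ∃ t : ℚ, a = (t : ℝ) * c := by
  by_cases hc : c = 0
  · exact Or.inl hc
  right
  set t₀ : ℝ := a / c with ht₀
  have hat : a = t₀ * c := by rw [ht₀]; field_simp
  have hquad : latSharp32 k₀ 0 * t₀ ^ 2 + latSharp32 k₀ 1 * t₀ + latSharp32 k₀ 2 = 0 := by
    have : (latSharp32 k₀ 0 * t₀ ^ 2 + latSharp32 k₀ 1 * t₀ + latSharp32 k₀ 2) * c ^ 2 = 0 := by
      rw [hat] at hiso; linear_combination hiso
    rcases mul_eq_zero.mp this with h | h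
    · exact h
    · exact absurd (pow_eq_zero_iff two_ne_zero |>.mp h) hc
  rw [latSharp32_zero, latSharp32_one, latSharp32_two] at hquad
  have hΔR : ((k₀ 1 : ℝ)) ^ 2 - 128 * (k₀ 0 : ℝ) * (k₀ 2 : ℝ) = (m₀ : ℝ) ^ 2 := by
    have : ((discK k₀ : ℤ) : ℝ) = ((m₀ ^ 2 : ℤ) : ℝ) := by rw [hΔ]
    rw [discK] at this; push_cast at this; linarith
  by_cases hk0 : k₀ 0 = 0
  · -- linear case
    have hk0R : (k₀ 0 : ℝ) = 0 := by exact_mod_cast hk0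
    have hk1 : (k₀ 1 : ℝ) ≠ 0 := by
      intro h1
      rw [hk0R, h1] at hΔR
      have : (m₀ : ℝ) ^ 2 = 0 := by linarith
      have hm : (m₀ : ℝ) = 0 := pow_eq_zero_iff two_ne_zero |>.mp this
      have : (0 : ℝ) < m₀ := by exact_mod_cast hm₀
      linarith
    refine ⟨-(k₀ 2 : ℚ) / (k₀ 1 : ℚ), ?_⟩
    rw [hat]
    congr 1
    rw [hk0R] at hquad
    have : t₀ = -(k₀ 2 : ℝ) / (k₀ 1 : ℝ) := by
      field_simp
      linarith
    rw [this]; push_cast; ring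
  · -- quadratic case: `t₀` is one of the two rational roots
    have hk0R : (k₀ 0 : ℝ) ≠ 0 := by exact_mod_cast hk0
    set r₁ : ℚ := (-(k₀ 1 : ℚ) - m₀) / (64 * k₀ 0) with hr₁
    set r₂ : ℚ := (-(k₀ 1 : ℚ) + m₀) / (64 * k₀ 0) with hr₂
    have hr₁R : ((r₁ : ℚ) : ℝ) = (-(k₀ 1 : ℝ) - m₀) / (64 * k₀ 0) := by rw [hr₁]; push_cast; ring
    have hr₂R : ((r₂ : ℚ) : ℝ) = (-(k₀ 1 : ℝ) + m₀) / (64 * k₀ 0) := by rw [hr₂]; push_cast; ring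
    have hfac : 32 * (k₀ 0 : ℝ) * t₀ ^ 2 + (k₀ 1 : ℝ) * t₀ + (k₀ 2 : ℝ) =
        32 * (k₀ 0 : ℝ) * (t₀ - (r₁ : ℝ)) * (t₀ - (r₂ : ℝ)) := by
      rw [hr₁R, hr₂R]
      field_simp
      linear_combination (-(32:ℝ)) * hΔR
    rw [hfac] at hquad
    rcases mul_eq_zero.mp hquad with h | h
    · rcases mul_eq_zero.mp h with h' | h'
      · exfalso
        rcases mul_eq_zero.mp h' with h'' | h''
        · norm_num at h''
        · exact hk0R h''
      · exact ⟨r₁, by rw [hat]; congr 1; linarith⟩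
    · exact ⟨r₂, by rw [hat]; congr 1; linarith⟩

/-! ### Ray decay of `(φ|M) K · τ` at `∞` and at `0` -/


/-- **Decay at `∞` along rays**: `(φ|M)(τ) K τ → 0` as `|τ| → ∞` when `M∞` is a cusp
(`M = A N`, `A ∈ SL₂(ℤ)`, `N` upper triangular). [folklore] -/
theorem tendsto_slashSL_mul_atTop32 (f : CuspForm (Gamma0 32) 2) {M : SL(2, ℝ)} {A : SL(2, ℤ)} {Nu : SL(2, ℝ)}
    (hN : (Nu 1 0 : ℝ) = 0) (hMfac : M = ((A : SL(2, ℤ)) : SL(2, ℝ)) * Nu) (K : ℂ) {θ : ℝ} (hθ : θ ∈ Ioo 0 π) :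
    Tendsto (fun r : ℝ ↦ slashSL f M (polarPt r θ) * K * polarPt r θ) atTop (𝓝 0) := by
  obtain ⟨B, hB0, hB⟩ := exists_inv_denom_sq_le_atTop M hθ
  have hdec := tendsto_pow_mul_norm_cusp32 f A Nu hN hθ 1
  rw [← hMfac] at hdec
  rw [tendsto_zero_iff_norm_tendsto_zero]
  refine squeeze_zero' ((eventually_ge_atTop 1).mono fun r _ ↦ norm_nonneg _)
    ((eventually_ge_atTop 1).mono fun r hr ↦ ?_) (by simpa using hdec.mul_const (‖K‖ * B))
  have hr0 : 0 < r := by linarith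
  rw [norm_slashSL_mul_polarPt _ M K hr0]
  have hf0 : 0 ≤ ‖f (M • UpperHalfPlane.ofComplex (polarPt r θ))‖ := norm_nonneg _
  calc ‖f (M • UpperHalfPlane.ofComplex (polarPt r θ))‖ * ‖K‖ * r /
        ‖((M 1 0 : ℝ) : ℂ) * polarPt r θ + ((M 1 1 : ℝ) : ℂ)‖ ^ 2
      = r * ‖f (M • UpperHalfPlane.ofComplex (polarPt r θ))‖ * ‖K‖ *
          (1 / ‖((M 1 0 : ℝ) : ℂ) * polarPt r θ + ((M 1 1 : ℝ) : ℂ)‖ ^ 2) := by ring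
    _ ≤ r * ‖f (M • UpperHalfPlane.ofComplex (polarPt r θ))‖ * ‖K‖ * B := by
        gcongr
        exact hB r hr
    _ = r * ‖f (M • UpperHalfPlane.ofComplex (polarPt r θ))‖ * (‖K‖ * B) := by ring


/-- **Decay at `0` along rays**: `(φ|M)(τ) K τ → 0` as `|τ| → 0⁺` when `M0` is a cusp
(`M S⁻¹ = A' N'`). [folklore] -/
theorem tendsto_slashSL_mul_nhdsGT_zero32 (f : CuspForm (Gamma0 32) 2) {M : SL(2, ℝ)} {A' : SL(2, ℤ)}
    {Nu' : SL(2, ℝ)} (hN' : (Nu' 1 0 : ℝ) = 0)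
    (hPfac : M * (((ModularGroup.S : SL(2, ℤ)) : SL(2, ℝ)))⁻¹ = ((A' : SL(2, ℤ)) : SL(2, ℝ)) * Nu') (K : ℂ)
    {θ : ℝ} (hθ : θ ∈ Ioo 0 π) :
    Tendsto (fun r : ℝ ↦ slashSL f M (polarPt r θ) * K * polarPt r θ) (𝓝[>] 0) (𝓝 0) := by
  have hθ' : π - θ ∈ Ioo 0 π := ⟨by linarith [hθ.2], by linarith [hθ.1]⟩
  obtain ⟨B, r₀, hB0, hr₀, hB⟩ := exists_denom_bound_nhds_zero M θ
  have hdec := (tendsto_pow_mul_norm_cusp32 f A' Nu' hN' hθ' 1).comp tendsto_inv_nhdsGT_zero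
  rw [← hPfac] at hdec
  -- the point identity `M τ = (M S⁻¹)(S τ)`
  have hpt : ∀ r : ℝ, 0 < r → M • UpperHalfPlane.ofComplex (polarPt r θ) =
      (M * (((ModularGroup.S : SL(2, ℤ)) : SL(2, ℝ)))⁻¹) • UpperHalfPlane.ofComplex (polarPt r⁻¹ (π - θ)) := by
    intro r hr
    rw [← S_smul_ofComplex_polarPt hr hθ, mul_smul,
      show ModularGroup.S • UpperHalfPlane.ofComplex (polarPt r θ) =
        (((ModularGroup.S : SL(2, ℤ)) : SL(2, ℝ))) • UpperHalfPlane.ofComplex (polarPt r θ) from rfl,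
      inv_smul_smul]
  rw [tendsto_zero_iff_norm_tendsto_zero]
  have hev : ∀ᶠ r : ℝ in 𝓝[>] 0, 0 < r ∧ r < r₀ := by
    filter_upwards [Ioo_mem_nhdsGT hr₀] with r hr using hr
  refine squeeze_zero' (hev.mono fun r _ ↦ norm_nonneg _) (hev.mono fun r ⟨hr, hrr⟩ ↦ ?_)
    (by simpa using hdec.mul_const (‖K‖ * B))
  rw [norm_slashSL_mul_polarPt _ M K hr, hpt r hr]
  set F := ‖f ((M * (((ModularGroup.S : SL(2, ℤ)) : SL(2, ℝ)))⁻¹) • UpperHalfPlane.ofComplex (polarPt r⁻¹ (π - θ)))‖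
  have hF : 0 ≤ F := norm_nonneg _
  calc F * ‖K‖ * r / ‖((M 1 0 : ℝ) : ℂ) * polarPt r θ + ((M 1 1 : ℝ) : ℂ)‖ ^ 2
      = F * ‖K‖ * (r / ‖((M 1 0 : ℝ) : ℂ) * polarPt r θ + ((M 1 1 : ℝ) : ℂ)‖ ^ 2) := by ring
    _ ≤ F * ‖K‖ * (B * r⁻¹) := by gcongr; exact hB r hr hrr
    _ = r⁻¹ * F * (‖K‖ * B) := by ring

/-! ### Integrability of the polar integrand from integrability on the plane -/


/-! ### Integrability along rays -/

/-- The ray function `r ↦ (φ|M)(r e^{iθ}) K e^{iθ}` is continuous on `(0, ∞)`. [folklore] -/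
theorem continuousOn_ray32 (f : CuspForm (Gamma0 32) 2) (M : SL(2, ℝ)) (K : ℂ) {θ : ℝ} (hθ : θ ∈ Ioo 0 π) :
    ContinuousOn (fun r : ℝ ↦ slashSL f M (polarPt r θ) * K * unitAt θ) (Ioi 0) := by
  have hsin : 0 < Real.sin θ := Real.sin_pos_of_pos_of_lt_pi hθ.1 hθ.2
  have hpt : Continuous fun r : ℝ ↦ polarPt r θ := by unfold polarPt; fun_prop
  have hmaps : MapsTo (fun r : ℝ ↦ polarPt r θ) (Ioi 0) {w : ℂ | 0 < w.im} := by
    intro r hr; show 0 < (polarPt r θ).im; rw [polarPt_im]; exact mul_pos hr hsin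
  have h1 : ContinuousOn (fun r : ℝ ↦ slashSL f M (polarPt r θ)) (Ioi 0) :=
    (differentiableOn_slashSL32 f M).continuousOn.comp hpt.continuousOn hmaps
  exact (h1.mul continuousOn_const).mul continuousOn_const


/-- **Integrability along rays** for `(φ|M) K` when both `M∞` and `M0` are cusps. [folklore] -/
theorem integrableOn_ray32 (f : CuspForm (Gamma0 32) 2) {M : SL(2, ℝ)} {A A' : SL(2, ℤ)} {Nu Nu' : SL(2, ℝ)}
    (hN : (Nu 1 0 : ℝ) = 0) (hMfac : M = ((A : SL(2, ℤ)) : SL(2, ℝ)) * Nu)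
    (hN' : (Nu' 1 0 : ℝ) = 0)
    (hPfac : M * (((ModularGroup.S : SL(2, ℤ)) : SL(2, ℝ)))⁻¹ = ((A' : SL(2, ℤ)) : SL(2, ℝ)) * Nu')
    (K : ℂ) {θ : ℝ} (hθ : θ ∈ Ioo 0 π) :
    IntegrableOn (fun r : ℝ ↦ slashSL f M (polarPt r θ) * K * unitAt θ) (Ioi 0) := by
  have hθ' : π - θ ∈ Ioo 0 π := ⟨by linarith [hθ.2], by linarith [hθ.1]⟩
  have hcont := continuousOn_ray32 f M K hθ
  -- tail: `r³ ‖φ(M τ_r)‖ ≤ 1` for `r ≥ R ≥ 1`, and `1/|den|² ≤ B`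
  obtain ⟨B, hB0, hB⟩ := exists_inv_denom_sq_le_atTop M hθ
  have hdec := tendsto_pow_mul_norm_cusp32 f A Nu hN hθ 3
  rw [← hMfac] at hdec
  have hevT := (hdec.eventually (ge_mem_nhds (show (0:ℝ) < 1 by norm_num)))
  rw [Filter.eventually_atTop] at hevT
  obtain ⟨R₀, hR₀⟩ := hevT
  set R : ℝ := max R₀ 1 with hR
  have hR1 : 1 ≤ R := le_max_right _ _
  -- head: `‖φ(M τ_r)‖ ≤ r²` for `0 < r < r₁`, and `r/|den|² ≤ B' r⁻¹`
  obtain ⟨B', r₀, hB'0, hr₀, hB'⟩ := exists_denom_bound_nhds_zero M θ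
  have hdec0 := (tendsto_pow_mul_norm_cusp32 f A' Nu' hN' hθ' 2).comp tendsto_inv_nhdsGT_zero
  rw [← hPfac] at hdec0
  have hev0 := hdec0.eventually (ge_mem_nhds (show (0:ℝ) < 1 by norm_num))
  obtain ⟨r₁', hr₁'pos, hr₁'⟩ := (nhdsGT_basis (0 : ℝ)).eventually_iff.mp hev0
  set r₁ : ℝ := min (min (r₁' / 2) (r₀ / 2)) R with hr₁def
  have hr₁pos : 0 < r₁ := lt_min (lt_min (by linarith) (by linarith)) (by linarith)
  have hr₁R : r₁ ≤ R := min_le_right _ _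
  have hr₁a : r₁ < r₁' := by
    have : r₁ ≤ r₁' / 2 := (min_le_left _ _).trans (min_le_left _ _)
    linarith
  have hr₁b : r₁ < r₀ := by
    have : r₁ ≤ r₀ / 2 := (min_le_left _ _).trans (min_le_right _ _)
    linarith
  have hpt : ∀ r : ℝ, 0 < r → M • UpperHalfPlane.ofComplex (polarPt r θ) =
      (M * (((ModularGroup.S : SL(2, ℤ)) : SL(2, ℝ)))⁻¹) • UpperHalfPlane.ofComplex (polarPt r⁻¹ (π - θ)) := by
    intro r hr
    rw [← S_smul_ofComplex_polarPt hr hθ, mul_smul,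
      show ModularGroup.S • UpperHalfPlane.ofComplex (polarPt r θ) =
        (((ModularGroup.S : SL(2, ℤ)) : SL(2, ℝ))) • UpperHalfPlane.ofComplex (polarPt r θ) from rfl,
      inv_smul_smul]
  -- decomposition `(0, ∞) = (0, r₁] ∪ [r₁, R] ∪ (R, ∞)`
  have hunion : Ioi (0 : ℝ) = (Ioc 0 r₁ ∪ Icc r₁ R) ∪ Ioi R := by
    rw [Ioc_union_Icc_eq_Ioc hr₁pos hr₁R, Ioc_union_Ioi_eq_Ioi (by linarith)]
  rw [hunion]
  refine IntegrableOn.union (IntegrableOn.union ?_ ?_) ?_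
  · -- bounded on `(0, r₁]`
    refine ⟨(hcont.mono Ioc_subset_Ioi_self).aestronglyMeasurable measurableSet_Ioc,
      HasFiniteIntegral.of_bounded (C := ‖K‖ * B') ?_⟩
    rw [ae_restrict_iff' measurableSet_Ioc]
    refine Eventually.of_forall fun r hr ↦ ?_
    have hr0 : 0 < r := hr.1
    have hrr₀ : r < r₀ := lt_of_le_of_lt hr.2 hr₁b
    have hrr₁' : r ∈ Ioo 0 r₁' := ⟨hr0, lt_of_le_of_lt hr.2 hr₁a⟩
    have hf2 : ‖f (M • UpperHalfPlane.ofComplex (polarPt r θ))‖ ≤ r ^ 2 := by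
      have h := hr₁' hrr₁'
      simp only [Function.comp_apply] at h
      rw [hpt r hr0]
      have hr2 : 0 < r ^ 2 := by positivity
      have : (r⁻¹) ^ 2 * ‖f ((M * (((ModularGroup.S : SL(2, ℤ)) : SL(2, ℝ)))⁻¹) •
          UpperHalfPlane.ofComplex (polarPt r⁻¹ (π - θ)))‖ * r ^ 2 ≤ 1 * r ^ 2 :=
        mul_le_mul_of_nonneg_right h hr2.le
      rwa [one_mul, mul_comm, ← mul_assoc, inv_pow, mul_inv_cancel₀ hr2.ne', one_mul] at this
    rw [norm_ray]
    have hden := hB' r hr0 hrr₀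
    have hdenpos : 0 < ‖((M 1 0 : ℝ) : ℂ) * polarPt r θ + ((M 1 1 : ℝ) : ℂ)‖ ^ 2 := by
      have := sl_denom_ne_zero_real M (UpperHalfPlane.ofComplex (polarPt r θ))
      rw [coe_ofComplex_polarPt hr0 hθ] at this
      positivity
    calc ‖f (M • UpperHalfPlane.ofComplex (polarPt r θ))‖ * ‖K‖ /
          ‖((M 1 0 : ℝ) : ℂ) * polarPt r θ + ((M 1 1 : ℝ) : ℂ)‖ ^ 2
        ≤ r ^ 2 * ‖K‖ / ‖((M 1 0 : ℝ) : ℂ) * polarPt r θ + ((M 1 1 : ℝ) : ℂ)‖ ^ 2 := by gcongr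
      _ = ‖K‖ * r * (r / ‖((M 1 0 : ℝ) : ℂ) * polarPt r θ + ((M 1 1 : ℝ) : ℂ)‖ ^ 2) := by ring
      _ ≤ ‖K‖ * r * (B' * r⁻¹) := by gcongr
      _ = ‖K‖ * B' := by field_simp
  · exact (hcont.mono (Icc_subset_Ioi_iff hr₁R |>.mpr hr₁pos)).integrableOn_Icc
  · -- tail `(R, ∞)`: `‖·‖ ≤ ‖K‖ B r⁻³`
    have hRpos : 0 < R := by linarith
    have hg0 : IntegrableOn (fun r : ℝ ↦ r ^ (-3 : ℝ)) (Ioi R) := integrableOn_Ioi_rpow_of_lt (by norm_num) hRpos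
    have hg : IntegrableOn (fun r : ℝ ↦ ‖K‖ * B * (r ^ 3)⁻¹) (Ioi R) := by
      refine (hg0.congr_fun (fun r hr ↦ ?_) measurableSet_Ioi).const_mul (‖K‖ * B)
      have hr0 : 0 < r := hRpos.trans hr
      rw [Real.rpow_neg hr0.le, show (3 : ℝ) = ((3 : ℕ) : ℝ) by norm_num, Real.rpow_natCast]
    refine Integrable.mono' hg ((hcont.mono (Ioi_subset_Ioi hRpos.le)).aestronglyMeasurable measurableSet_Ioi) ?_
    rw [ae_restrict_iff' measurableSet_Ioi]
    refine Eventually.of_forall fun r hr ↦ ?_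
    have hrR : R < r := hr
    have hr1 : 1 ≤ r := hR1.trans hrR.le
    have hr0 : 0 < r := by linarith
    have hr3 : 0 < r ^ 3 := by positivity
    have hf3 : ‖f (M • UpperHalfPlane.ofComplex (polarPt r θ))‖ ≤ (r ^ 3)⁻¹ := by
      have h := hR₀ r ((le_max_left _ _).trans hrR.le)
      have e : ‖f (M • UpperHalfPlane.ofComplex (polarPt r θ))‖ =
          (r ^ 3 * ‖f (M • UpperHalfPlane.ofComplex (polarPt r θ))‖) * (r ^ 3)⁻¹ := by
        field_simp
      rw [e]
      calc (r ^ 3 * ‖f (M • UpperHalfPlane.ofComplex (polarPt r θ))‖) * (r ^ 3)⁻¹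
          ≤ 1 * (r ^ 3)⁻¹ := by gcongr
        _ = (r ^ 3)⁻¹ := one_mul _
    rw [norm_ray]
    have hden := hB r hr1
    calc ‖f (M • UpperHalfPlane.ofComplex (polarPt r θ))‖ * ‖K‖ /
          ‖((M 1 0 : ℝ) : ℂ) * polarPt r θ + ((M 1 1 : ℝ) : ℂ)‖ ^ 2
        = ‖f (M • UpperHalfPlane.ofComplex (polarPt r θ))‖ * ‖K‖ *
            (1 / ‖((M 1 0 : ℝ) : ℂ) * polarPt r θ + ((M 1 1 : ℝ) : ℂ)‖ ^ 2) := by ring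
      _ ≤ (r ^ 3)⁻¹ * ‖K‖ * B := by gcongr
      _ = ‖K‖ * B * (r ^ 3)⁻¹ := by ring

/-! ### The two factorizations for a split vector -/


/-- **Both `M∞` and `M0` are cusps for a split vector**: the factorizations `M = A N` and
`M S⁻¹ = A' N'` (`A, A' ∈ SL₂(ℤ)`, `N, N'` upper triangular). [folklore] -/
theorem exists_factorizations_of_sq32 {k₀ : Fin 3 → ℤ} {m₀ : ℤ} (hm₀ : 0 < m₀) (hΔ : discK k₀ = m₀ ^ 2)
    {M : SL(2, ℝ)} {lam : ℝ} (hM : actSL M (latSharp32 k₀) = xyForm lam) :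
    (∃ (A : SL(2, ℤ)) (Nu : SL(2, ℝ)), (Nu 1 0 : ℝ) = 0 ∧ M = ((A : SL(2, ℤ)) : SL(2, ℝ)) * Nu) ∧
    (∃ (A' : SL(2, ℤ)) (Nu' : SL(2, ℝ)), (Nu' 1 0 : ℝ) = 0 ∧
      M * (((ModularGroup.S : SL(2, ℤ)) : SL(2, ℝ)))⁻¹ = ((A' : SL(2, ℤ)) : SL(2, ℝ)) * Nu') := by
  constructor
  · have hiso := isotropic_col0 hM
    have hrat := isotropic_dir_rational32 hm₀ hΔ (a := (M 0 0 : ℝ)) (c := (M 1 0 : ℝ)) (by linear_combination hiso)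
    obtain ⟨p, q, hpq, hdir⟩ := exists_coprime_direction hrat
    exact exists_sl2z_mul_upper M hpq hdir
  · have hiso := isotropic_col1 hM
    obtain ⟨h00, h10⟩ := mul_S_inv_col M
    have hrat := isotropic_dir_rational32 hm₀ hΔ (a := -(M 0 1 : ℝ)) (c := -(M 1 1 : ℝ)) (by linear_combination hiso)
    obtain ⟨p, q, hpq, hdir⟩ := exists_coprime_direction hrat
    refine exists_sl2z_mul_upper _ hpq ?_
    rw [h00, h10]; exact hdir

/-! ### The split orbit integral -/

variable (cw : (Fin 3 → ℤ) → ℂ) (tS : ℝ) (htS : 0 < tS)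


/-- **The orbit integral of a split indefinite vector** (`c` invariant and bounded, `φ ∈ S₂(Γ₀(32))`): for `ω` with
`Δ(k_ω) = m₀² > 0` (a form with rational roots, i.e. a pair of cusps), with `M ∈ SL₂(ℝ)` moving
the roots to `∞, 0` (`ι♮(k_ω) ∘ M = λXY`),
`J(ω) = c_D(k_ω) λ e(λ²Z) · (∫₀^∞ (φ|M)(iy) i dy) · √(π/(4π Im Z λ²))` — the stabiliser is trivial,
the orbit integral is over all of `ℍ`, and Shintani's evaluation gives the complete period of `φ`
between the two cusps (`ShintaniOrbitIntegrals.integral_sectorSet_Ioi_eq_mul_sqrt`).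
[cite: Shintani1975, §2, Prop. 2.4 and proof of Prop. 2.3] -/
theorem orbitIntegral_splitG {cw : (Fin 3 → ℤ) → ℂ} (hinv : InvWeight32 cw) (hb : BddWeight cw) (tS : ℝ) (htS : 0 < tS)
    (f : CuspForm (Gamma0 32) 2) (z : ℍ)
    (ω : orbitRel.Quotient (Gamma0Plus 32) (Fin 3 → ℤ)) {m₀ : ℤ} (hm₀ : 0 < m₀)
    (hΔ : discK ω.out = m₀ ^ 2) :
    ∃ (M : SL(2, ℝ)) (lam : ℝ), lam ≠ 0 ∧ actSL M (latSharp32 ω.out) = xyForm lam ∧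
      orbitIntegralG cw tS htS f z ω = anisoConstG cw tS htS z ω.out lam *
        (∫ r in Ioi (0 : ℝ), slashSL f M (polarPt r (π / 2)) * unitAt (π / 2)) *
          (Real.sqrt (π / (4 * π * (mulPos tS htS z : ℂ).im * lam ^ 2)) : ℝ) := by
  set k₀ := ω.out with hk₀
  have hposR : 0 < disc (latSharp32 k₀) := by
    rw [disc_latSharp32_eq_discK, hΔ]; push_cast; exact pow_pos (by exact_mod_cast hm₀) 2
  obtain ⟨a, b, c, d, lam, hdet, hlam, hconj⟩ := exists_conj_to_xyForm hposR
  set M : SL(2, ℝ) := slOf a b c d hdet with hMdef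
  have hM : actSL M (latSharp32 k₀) = xyForm lam := by rw [hMdef, actSL_slOf]; exact hconj
  refine ⟨M, lam, hlam, hM, ?_⟩
  obtain ⟨⟨A, Nu, hN, hMfac⟩, ⟨A', Nu', hN', hPfac⟩⟩ := exists_factorizations_of_sq32 hm₀ hΔ hM
  -- trivial stabiliser: `orbitDomain32` and `univ` are both fundamental domains
  have hbot := stabK_eq_bot_of_sq32 hm₀ hΔ (k₀ := k₀)
  haveI : Subsingleton (stabK32 k₀) := by rw [hbot]; infer_instance
  have hFD := isFundamentalDomain_orbitDomain32 k₀
  have hFD' : IsFundamentalDomain (stabK32 k₀) (Set.univ : Set ℍ) (volume : Measure ℍ) :=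
    isFundamentalDomain_univ_of_subsingleton
  have hstab : ∀ (γ : stabK32 k₀) (w : ℍ), liftTermG cw tS htS f z k₀ (γ • w) = liftTermG cw tS htS f z k₀ w :=
    liftTermG_stab_invariant hinv tS htS f z k₀
  -- integrability on `ℍ`, transported and moved to the plane
  have hintH : IntegrableOn (liftTermG cw tS htS f z k₀) Set.univ (volume : Measure ℍ) :=
    (hFD.integrableOn_iff hFD' hstab).mp (tsum_quotient_integral_liftTermG_eq hinv hb tS htS f z k₀).1
  have hintM : IntegrableOn (fun u ↦ liftTermG cw tS htS f z k₀ (M • u)) Set.univ (volume : Measure ℍ) := by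
    rw [← integrableOn_sl_smul_set_real_iff M, Set.smul_set_univ]; exact hintH
  set ψ : ℂ → ℂ := fun τ ↦ slashSL f M τ * anisoConstG cw tS htS z k₀ lam with hψdef
  set cc : ℝ := 4 * π * (mulPos tS htS z : ℂ).im * lam ^ 2 with hcc
  have hcpos : 0 < cc := by
    have h1 : 0 < (mulPos tS htS z : ℂ).im := by rw [UpperHalfPlane.coe_im]; exact (mulPos tS htS z).im_pos
    positivity
  have hplane_eq : ∀ w : ℂ, 0 < w.im →
      ((1 / w.im ^ 2 : ℝ) : ℂ) * liftTermG cw tS htS f z k₀ (M • UpperHalfPlane.ofComplex w) = planeIntegrand ψ cc w := by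
    intro w hw
    rw [liftTermG_sl_smul cw tS htS f z hM, planeIntegrand, UpperHalfPlane.ofComplex_apply_of_im_pos hw]
  have hplane : IntegrableOn (planeIntegrand ψ cc) {w : ℂ | 0 < w.im} := by
    have h := (FdCoord.integrableOn_image_iff (fun u ↦ liftTermG cw tS htS f z k₀ (M • u)) MeasurableSet.univ).mpr hintM
    rw [image_univ, UpperHalfPlane.range_coe] at h
    exact h.congr_fun (fun w hw ↦ hplane_eq w hw) (measurableSet_lt measurable_const Complex.measurable_im)
  -- the sibling's evaluation
  obtain ⟨C₀, -, hC₀⟩ := exists_norm_mul_im_le f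
  have hCψ : ∀ w : ℂ, 0 < w.im → ‖ψ w‖ * w.im ≤ C₀ * ‖anisoConstG cw tS htS z k₀ lam‖ := by
    intro w hw
    calc ‖slashSL f M w * anisoConstG cw tS htS z k₀ lam‖ * w.im
        = (‖slashSL f M w‖ * w.im) * ‖anisoConstG cw tS htS z k₀ lam‖ := by rw [norm_mul]; ring
      _ ≤ C₀ * ‖anisoConstG cw tS htS z k₀ lam‖ :=
        mul_le_mul_of_nonneg_right (norm_slashSL_mul_im_le32 f M hC₀ hw) (norm_nonneg _)
  have hψhol : DifferentiableOn ℂ ψ {w : ℂ | 0 < w.im} := (differentiableOn_slashSL32 f M).mul_const _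
  have key := integral_sectorSet_Ioi_eq_mul_sqrt (ψ := ψ) (c := cc) hψhol hCψ
    (fun y hy ↦ tendsto_slashSL_mul_nhdsGT_zero32 f hN' hPfac _ hy)
    (fun y hy ↦ tendsto_slashSL_mul_atTop32 f hN hMfac _ hy)
    (fun θ hθ ↦ integrableOn_ray32 f hN hMfac hN' hPfac _ hθ)
    (integrableOn_polarIntegrand_of_plane hψhol.continuousOn hplane)
  -- assemble
  unfold orbitIntegralG
  rw [← hk₀, hFD.setIntegral_eq hFD' hstab, ← Set.smul_set_univ (a := M), setIntegral_sl_smul_set_real,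
    FdCoord.setIntegral_eq_setIntegral_image _ MeasurableSet.univ, image_univ, UpperHalfPlane.range_coe]
  rw [show (UpperHalfPlane.upperHalfPlaneSet : Set ℂ) = {w : ℂ | 0 < w.im} from rfl,
    setIntegral_congr_fun (measurableSet_lt measurable_const Complex.measurable_im) (fun w hw ↦ hplane_eq w hw),
    setOf_im_pos_eq_sectorSet, key]
  -- pull the constant out of the ray integral
  have hray : ∫ r in Ioi (0 : ℝ), ψ (polarPt r (π / 2)) * unitAt (π / 2) =
      anisoConstG cw tS htS z k₀ lam * ∫ r in Ioi (0 : ℝ), slashSL f M (polarPt r (π / 2)) * unitAt (π / 2) := by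
    rw [← integral_const_mul]
    refine integral_congr_ae (Eventually.of_forall fun r ↦ ?_)
    simp only [hψdef]; ring
  rw [hray]

end Literature.NumberTheory.EllipticCurves.Shintani

noncomputable section

open scoped MatrixGroups ModularForm Modular Topology
open UpperHalfPlane hiding I
open Complex Filter MeasureTheory Set CongruenceSubgroup ModularGroup Real MulAction
open Literature.NumberTheory.EllipticCurves.ModularForms

namespace Literature.NumberTheory.EllipticCurves.Shintani

/-! ### The real Möbius map of `M ∈ SL₂(ℝ)` and its derivative -/


/-! ### The Eichler integral along the axis `M(iy)` -/

variable (f : CuspForm (Gamma0 32) 2)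

/-- `F_M(y) = E_f(M(iy))`, the Eichler integral along the image of the imaginary axis. [folklore] -/
def axisE32 (M : SL(2, ℝ)) (y : ℝ) : ℂ :=
  eichlerIntegral f (UpperHalfPlane.ofComplex (moebR M ((y : ℂ) * I)))

/-- **`d/dy E_f(M(iy)) = 2πi · (φ|M)(iy) · i`** for `y > 0`. [folklore] -/
theorem hasDerivAt_axisE32 (M : SL(2, ℝ)) {y : ℝ} (hy : 0 < y) :
    HasDerivAt (axisE32 f M) (2 * Real.pi * I * (slashSL f M ((y : ℂ) * I) * I)) y := by
  have hτ : 0 < (((y : ℂ) * I)).im := by simpa using hy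
  have him := moeb_im_pos M hτ
  -- complex chain rule for `w ↦ E(ofComplex (moebR M (w I)))` at `w = y`
  have h1 : HasDerivAt (fun w : ℂ ↦ w * I) I (y : ℂ) := by simpa using (hasDerivAt_id (y : ℂ)).mul_const I
  have h2 : HasDerivAt ((moebR M) ∘ (fun w : ℂ ↦ w * I))
      (1 / (((M 1 0 : ℝ) : ℂ) * ((y : ℂ) * I) + ((M 1 1 : ℝ) : ℂ)) ^ 2 * I) (y : ℂ) :=
    HasDerivAt.comp (y : ℂ) (hasDerivAt_moebR M hτ) h1
  have h3 := hasDerivAt_eichlerIntegral f him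
  have h4 : HasDerivAt ((fun w : ℂ ↦ eichlerIntegral f (UpperHalfPlane.ofComplex w)) ∘ ((moebR M) ∘ (fun w : ℂ ↦ w * I)))
      (2 * Real.pi * I * f (UpperHalfPlane.ofComplex (moebR M ((y : ℂ) * I))) *
        (1 / (((M 1 0 : ℝ) : ℂ) * ((y : ℂ) * I) + ((M 1 1 : ℝ) : ℂ)) ^ 2 * I)) (y : ℂ) :=
    HasDerivAt.comp (y : ℂ) h3 h2
  have h5 : HasDerivAt (axisE32 f M) (2 * Real.pi * I * f (UpperHalfPlane.ofComplex (moebR M ((y : ℂ) * I))) *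
        (1 / (((M 1 0 : ℝ) : ℂ) * ((y : ℂ) * I) + ((M 1 1 : ℝ) : ℂ)) ^ 2 * I)) y :=
    h4.comp_ofReal
  refine h5.congr_deriv ?_
  -- identify the derivative with `2πi (φ|M)(iy) i`
  have hpt : UpperHalfPlane.ofComplex (moebR M ((y : ℂ) * I)) = M • UpperHalfPlane.ofComplex ((y : ℂ) * I) := by
    apply UpperHalfPlane.ext
    rw [coe_sl_smul_ofComplex M hτ]
    have h := UpperHalfPlane.ofComplex_apply_of_im_pos him
    change UpperHalfPlane.ofComplex (moebR M ((y : ℂ) * I)) = _ at h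
    rw [h]
    rfl
  rw [hpt, slashSL]
  ring

/-- **FTC on a segment**: `∫_{y₁}^{y₂} (φ|M)(iy) i dy = (E(M(iy₂)) - E(M(iy₁)))/(2πi)`
(`0 < y₁ ≤ y₂`). [folklore] -/
theorem integral_slashSL_axis_eq32 (M : SL(2, ℝ)) {y₁ y₂ : ℝ} (hy₁ : 0 < y₁) (hy₁₂ : y₁ ≤ y₂)
    (hint : IntervalIntegrable (fun y : ℝ ↦ slashSL f M ((y : ℂ) * I) * I) volume y₁ y₂) :
    ∫ y in y₁..y₂, slashSL f M ((y : ℂ) * I) * I = (axisE32 f M y₂ - axisE32 f M y₁) / (2 * Real.pi * I) := by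
  have h2pi : (2 * Real.pi * I : ℂ) ≠ 0 := by
    apply mul_ne_zero (mul_ne_zero two_ne_zero (Complex.ofReal_ne_zero.mpr Real.pi_pos.ne')) Complex.I_ne_zero
  have hderiv : ∀ y ∈ Set.uIcc y₁ y₂, HasDerivAt (axisE32 f M) (2 * Real.pi * I * (slashSL f M ((y : ℂ) * I) * I)) y := by
    intro y hy
    rw [Set.uIcc_of_le hy₁₂] at hy
    exact hasDerivAt_axisE32 f M (hy₁.trans_le hy.1)
  have hFTC := intervalIntegral.integral_eq_sub_of_hasDerivAt hderiv (hint.const_mul (2 * Real.pi * I))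
  rw [intervalIntegral.integral_const_mul] at hFTC
  rw [eq_div_iff h2pi, mul_comm, hFTC]

/-! ### Decay of the vertical-ray integral of a cusp function -/


/-! ### The limits of `E(M(iy))` at `y → ∞` and `y → 0⁺` -/

/-- `M(iy) = A(N(iy))` and the point `N(iy)` for `M = A N`. [folklore] -/
theorem axisE32_eq_of_fac {M : SL(2, ℝ)} {A : SL(2, ℤ)} {Nu : SL(2, ℝ)}
    (hMfac : M = ((A : SL(2, ℤ)) : SL(2, ℝ)) * Nu) {y : ℝ} (hy : 0 < y) :
    axisE32 f M y = eichlerIntegral f (A • (Nu • UpperHalfPlane.ofComplex ((y : ℂ) * I))) := by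
  have hτ : 0 < (((y : ℂ) * I)).im := by simpa using hy
  rw [axisE32]
  congr 1
  apply UpperHalfPlane.ext
  rw [← coe_sl_smul_ofComplex M hτ, hMfac, mul_smul, UpperHalfPlane.ofComplex_apply]
  rfl

/-- **`E(M(iy)) → {∞, M∞}` as `y → ∞`** when `M∞ = A∞` is a finite cusp (`A₁₀ ≠ 0`). [folklore] -/
theorem tendsto_axisE32_atTop {M : SL(2, ℝ)} {A : SL(2, ℤ)} {Nu : SL(2, ℝ)} (hN : (Nu 1 0 : ℝ) = 0)
    (hMfac : M = ((A : SL(2, ℤ)) : SL(2, ℝ)) * Nu) (hA : (A 1 0 : ℤ) ≠ 0) :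
    Tendsto (axisE32 f M) atTop (𝓝 (modularSymbol f (((A 0 0 : ℤ) : ℚ) / ((A 1 0 : ℤ) : ℚ)))) := by
  -- `E(A τ) = {∞, a/c} + V_{f|A}(τ)` with `τ = N(iy)`, `Im τ = N₀₀² y → ∞`
  set τ : ℝ → ℍ := fun y ↦ Nu • UpperHalfPlane.ofComplex (((max y 1 : ℝ) : ℂ) * I) with hτdef
  have hkey : ∀ y : ℝ, 1 ≤ y → axisE32 f M y =
      modularSymbol f (((A 0 0 : ℤ) : ℚ) / ((A 1 0 : ℤ) : ℚ)) + verticalIntegral (⇑f ∣[(2 : ℤ)] A) (τ y) := by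
    intro y hy
    have hy0 : 0 < y := by linarith
    rw [axisE32_eq_of_fac f hMfac hy0, modularSymbol_smul_infty f A hA (τ y), hτdef]
    simp only [max_eq_left hy]
    ring
  have him : Tendsto (fun y ↦ (τ y).im) atTop atTop := by
    have hdet := det_entries_real Nu
    rw [hN, mul_zero, sub_zero] at hdet
    have ha : (Nu 0 0 : ℝ) ≠ 0 := by intro h0; rw [h0, zero_mul] at hdet; exact zero_ne_one hdet
    have ha2 : 0 < (Nu 0 0 : ℝ) ^ 2 := by positivity
    have e : ∀ y : ℝ, (τ y).im = (Nu 0 0 : ℝ) ^ 2 * max y 1 := by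
      intro y
      have hpos : 0 < (((max y 1 : ℝ) : ℂ) * I).im := by simp
      rw [hτdef]
      show (Nu • UpperHalfPlane.ofComplex (((max y 1 : ℝ) : ℂ) * I)).im = _
      rw [← UpperHalfPlane.coe_im, coe_upper_smul Nu hN, UpperHalfPlane.ofComplex_apply_of_im_pos hpos]
      simp [sq]
    simp_rw [e]
    exact (tendsto_atTop_mono (fun y ↦ le_max_left y 1) tendsto_id).const_mul_atTop ha2
  have hV := tendsto_verticalIntegral_of_im (isCuspFunction_slash f A) him
  have hsum := (tendsto_const_nhds (x := modularSymbol f (((A 0 0 : ℤ) : ℚ) / ((A 1 0 : ℤ) : ℚ)))).add hV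
  rw [add_zero] at hsum
  refine hsum.congr' ?_
  filter_upwards [eventually_ge_atTop (1 : ℝ)] with y hy using (hkey y hy).symm

/-- The value `{∞, A∞}` (`0` when `A∞ = ∞`). [folklore] -/
def cuspValue32 (A : SL(2, ℤ)) : ℂ :=
  if (A 1 0 : ℤ) = 0 then 0 else modularSymbol f (((A 0 0 : ℤ) : ℚ) / ((A 1 0 : ℤ) : ℚ))

/-- **`E(M(iy)) → {∞, M∞}` as `y → ∞`** for `M = A N` (both cases `A∞` finite or `∞`). [folklore] -/
theorem tendsto_axisE32_atTop' {M : SL(2, ℝ)} {A : SL(2, ℤ)} {Nu : SL(2, ℝ)} (hN : (Nu 1 0 : ℝ) = 0)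
    (hMfac : M = ((A : SL(2, ℤ)) : SL(2, ℝ)) * Nu) :
    Tendsto (axisE32 f M) atTop (𝓝 (cuspValue32 f A)) := by
  by_cases hA : (A 1 0 : ℤ) = 0
  · rw [cuspValue32, if_pos hA]
    -- `M` is upper triangular: `E(M(iy)) = V_f(M(iy)) → 0`
    have hM10 : (M 1 0 : ℝ) = 0 := by
      rw [hMfac]
      have e : ((((A : SL(2, ℤ)) : SL(2, ℝ)) * Nu : SL(2, ℝ)) 1 0 : ℝ) =
          (((A : SL(2, ℤ)) : SL(2, ℝ)) 1 0 : ℝ) * Nu 0 0 + (((A : SL(2, ℤ)) : SL(2, ℝ)) 1 1 : ℝ) * Nu 1 0 := by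
        simp [Matrix.mul_apply, Fin.sum_univ_two]
      rw [e, hN, mul_zero, add_zero]
      have : (((A : SL(2, ℤ)) : SL(2, ℝ)) 1 0 : ℝ) = ((A 1 0 : ℤ) : ℝ) := by
        simp [Matrix.SpecialLinearGroup.map_apply_coe]
      rw [this, hA]; simp
    have him : Tendsto (fun y : ℝ ↦ (M • UpperHalfPlane.ofComplex (((max y 1 : ℝ) : ℂ) * I)).im) atTop atTop := by
      have hdet := det_entries_real M
      rw [hM10, mul_zero, sub_zero] at hdet
      have ha : (M 0 0 : ℝ) ≠ 0 := by intro h0; rw [h0, zero_mul] at hdet; exact zero_ne_one hdet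
      have ha2 : 0 < (M 0 0 : ℝ) ^ 2 := by positivity
      have e : ∀ y : ℝ, (M • UpperHalfPlane.ofComplex (((max y 1 : ℝ) : ℂ) * I)).im = (M 0 0 : ℝ) ^ 2 * max y 1 := by
        intro y
        have hpos : 0 < (((max y 1 : ℝ) : ℂ) * I).im := by simp
        rw [← UpperHalfPlane.coe_im, coe_upper_smul M hM10, UpperHalfPlane.ofComplex_apply_of_im_pos hpos]
        simp [sq]
      simp_rw [e]
      exact (tendsto_atTop_mono (fun y ↦ le_max_left y 1) tendsto_id).const_mul_atTop ha2
    have hV := tendsto_verticalIntegral_of_im (isCuspFunction_one f) him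
    refine hV.congr' ?_
    filter_upwards [eventually_ge_atTop (1 : ℝ)] with y hy
    have hy0 : 0 < y := by linarith
    have hτ : 0 < (((y : ℂ) * I)).im := by simpa using hy0
    rw [axisE32, show eichlerIntegral f = verticalIntegral ⇑f from rfl, max_eq_left hy]
    congr 1
    apply UpperHalfPlane.ext
    rw [coe_sl_smul_ofComplex M hτ]
    have h := UpperHalfPlane.ofComplex_apply_of_im_pos (moeb_im_pos M hτ)
    change UpperHalfPlane.ofComplex (moebR M ((y : ℂ) * I)) = _ at h
    rw [h]
    rfl
  · rw [cuspValue32, if_neg hA]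
    exact tendsto_axisE32_atTop f hN hMfac hA

/-- `M(iy) = (M S⁻¹)(i/y)`: `axisE32 M y = axisE32 (M S⁻¹) y⁻¹` for `y > 0`. [folklore] -/
theorem axisE32_eq_axisE32_mul_S_inv (M : SL(2, ℝ)) {y : ℝ} (hy : 0 < y) :
    axisE32 f M y = axisE32 f (M * (((ModularGroup.S : SL(2, ℤ)) : SL(2, ℝ)))⁻¹) y⁻¹ := by
  have hτ : 0 < (((y : ℂ) * I)).im := by simpa using hy
  have hτ' : 0 < ((((y⁻¹ : ℝ) : ℂ)) * I).im := by simpa using hy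
  -- both points of `ℍ`
  have ept : ∀ (P : SL(2, ℝ)) {w : ℂ} (hw : 0 < w.im),
      UpperHalfPlane.ofComplex (moebR P w) = P • UpperHalfPlane.ofComplex w := by
    intro P w hw
    apply UpperHalfPlane.ext
    rw [coe_sl_smul_ofComplex P hw]
    have h := UpperHalfPlane.ofComplex_apply_of_im_pos (moeb_im_pos P hw)
    change UpperHalfPlane.ofComplex (moebR P w) = _ at h
    rw [h]
    rfl
  have hS := S_smul_ofComplex_polarPt hy (θ := π / 2) ⟨by positivity, by linarith [pi_pos]⟩
  rw [show π - π / 2 = π / 2 by ring, polarPt_pi_div_two, polarPt_pi_div_two] at hS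
  rw [axisE32, axisE32, ept M hτ]
  -- the right-hand point
  have hpt : (((y : ℝ) : ℂ))⁻¹ * I = (((y⁻¹ : ℝ)) : ℂ) * I := by push_cast; rfl
  have e2 := ept (M * (((ModularGroup.S : SL(2, ℤ)) : SL(2, ℝ)))⁻¹) hτ'
  rw [← hpt] at e2 hS ⊢
  rw [e2, ← hS, show ModularGroup.S • UpperHalfPlane.ofComplex ((y : ℂ) * I) =
      (((ModularGroup.S : SL(2, ℤ)) : SL(2, ℝ))) • UpperHalfPlane.ofComplex ((y : ℂ) * I) from rfl,
    ← mul_smul, inv_mul_cancel_right]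

/-- **`E(M(iy)) → {∞, M0}` as `y → 0⁺`** (`M S⁻¹ = A' N'`, `M0 = A'∞`). [folklore] -/
theorem tendsto_axisE32_nhdsGT_zero {M : SL(2, ℝ)} {A' : SL(2, ℤ)} {Nu' : SL(2, ℝ)} (hN' : (Nu' 1 0 : ℝ) = 0)
    (hPfac : M * (((ModularGroup.S : SL(2, ℤ)) : SL(2, ℝ)))⁻¹ = ((A' : SL(2, ℤ)) : SL(2, ℝ)) * Nu') :
    Tendsto (axisE32 f M) (𝓝[>] 0) (𝓝 (cuspValue32 f A')) := by
  have h := (tendsto_axisE32_atTop' f hN' hPfac).comp tendsto_inv_nhdsGT_zero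
  refine h.congr' ?_
  filter_upwards [self_mem_nhdsWithin] with y hy
  exact (axisE32_eq_axisE32_mul_S_inv f M hy).symm

/-- **The split period as modular symbols**: for `M = A N` and `M S⁻¹ = A' N'`
(`A, A' ∈ SL₂(ℤ)`, `N, N'` upper triangular),
`∫₀^∞ (φ|M)(iy) i dy = ({∞, M∞}_φ - {∞, M0}_φ) / (2πi)` with `{∞, r} = modularSymbol φ r`
(and `{∞, ∞} = 0`). [cite: Shintani1975, §2, Lemma 2.7 (ii); §3 (Manin's symbols)] -/
theorem period_eq_cuspValue32_sub {M : SL(2, ℝ)} {A A' : SL(2, ℤ)} {Nu Nu' : SL(2, ℝ)}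
    (hN : (Nu 1 0 : ℝ) = 0) (hMfac : M = ((A : SL(2, ℤ)) : SL(2, ℝ)) * Nu)
    (hN' : (Nu' 1 0 : ℝ) = 0)
    (hPfac : M * (((ModularGroup.S : SL(2, ℤ)) : SL(2, ℝ)))⁻¹ = ((A' : SL(2, ℤ)) : SL(2, ℝ)) * Nu') :
    ∫ r in Ioi (0 : ℝ), slashSL f M (polarPt r (π / 2)) * unitAt (π / 2) =
      (cuspValue32 f A - cuspValue32 f A') / (2 * Real.pi * I) := by
  set g : ℝ → ℂ := fun y ↦ slashSL f M ((y : ℂ) * I) * I with hgdef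
  have hfun : (fun r : ℝ ↦ slashSL f M (polarPt r (π / 2)) * unitAt (π / 2)) = g := by
    funext r; rw [hgdef, polarPt_pi_div_two, unitAt_pi_div_two]
  have hθ : π / 2 ∈ Ioo 0 π := ⟨by positivity, by linarith [pi_pos]⟩
  have hint : IntegrableOn g (Ioi 0) := by
    have h := integrableOn_ray32 f hN hMfac hN' hPfac 1 hθ
    rw [← hfun]
    exact h.congr_fun (fun r _ ↦ by ring) measurableSet_Ioi
  rw [hfun]
  -- Step A: the integral over `(y₁, ∞)`
  have hA : ∀ y₁ : ℝ, 0 < y₁ → ∫ y in Ioi y₁, g y = (cuspValue32 f A - axisE32 f M y₁) / (2 * Real.pi * I) := by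
    intro y₁ hy₁
    have hint₁ : IntegrableOn g (Ioi y₁) := hint.mono_set (Ioi_subset_Ioi hy₁.le)
    have T1 := intervalIntegral_tendsto_integral_Ioi y₁ hint₁ tendsto_id
    have T2 : Tendsto (fun b : ℝ ↦ ∫ y in y₁..b, g y) atTop (𝓝 ((cuspValue32 f A - axisE32 f M y₁) / (2 * Real.pi * I))) := by
      have hlim := ((tendsto_axisE32_atTop' f hN hMfac).sub_const (axisE32 f M y₁)).div_const (2 * Real.pi * I)
      refine hlim.congr' ?_
      filter_upwards [eventually_ge_atTop y₁] with b hb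
      have hii : IntervalIntegrable g volume y₁ b :=
        (intervalIntegrable_iff_integrableOn_Ioc_of_le hb).mpr (hint₁.mono_set Ioc_subset_Ioi_self)
      exact (integral_slashSL_axis_eq32 f M hy₁ hb hii).symm
    exact tendsto_nhds_unique T1 T2
  -- Step B: `∫_{(y₁, ∞)} g → ∫_{(0, ∞)} g` as `y₁ → 0⁺`
  have hsplit : ∀ y₁ : ℝ, 0 < y₁ → ∫ y in Ioi y₁, g y = (∫ y in Ioi 0, g y) - ∫ y in (0 : ℝ)..y₁, g y := by
    intro y₁ hy₁
    rw [intervalIntegral.integral_of_le hy₁.le, eq_sub_iff_add_eq, add_comm,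
      ← setIntegral_union (Set.Ioc_disjoint_Ioi le_rfl) measurableSet_Ioi
        (hint.mono_set Ioc_subset_Ioi_self) (hint.mono_set (Ioi_subset_Ioi hy₁.le)),
      Ioc_union_Ioi_eq_Ioi hy₁.le]
  have hprim : Tendsto (fun y₁ : ℝ ↦ ∫ y in (0 : ℝ)..y₁, g y) (𝓝[>] 0) (𝓝 0) := by
    have hcont : ContinuousWithinAt (fun b : ℝ ↦ ∫ y in (0 : ℝ)..b, g y) (Icc 0 1) 0 := by
      refine intervalIntegral.continuousWithinAt_primitive (measure_singleton 0) ?_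
      rw [min_self, max_eq_right zero_le_one]
      exact (intervalIntegrable_iff_integrableOn_Ioc_of_le zero_le_one).mpr (hint.mono_set Ioc_subset_Ioi_self)
    have h := hcont.tendsto
    rw [intervalIntegral.integral_same] at h
    rw [← nhdsWithin_Ioc_eq_nhdsGT zero_lt_one]
    exact h.mono_left (nhdsWithin_mono _ Ioc_subset_Icc_self)
  have TB : Tendsto (fun y₁ : ℝ ↦ ∫ y in Ioi y₁, g y) (𝓝[>] 0) (𝓝 (∫ y in Ioi 0, g y)) := by
    have h := (tendsto_const_nhds (x := ∫ y in Ioi 0, g y)).sub hprim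
    rw [sub_zero] at h
    refine h.congr' ?_
    filter_upwards [self_mem_nhdsWithin] with y₁ hy₁
    exact (hsplit y₁ hy₁).symm
  -- Step C: compare with the limit of Step A's right-hand side
  have TC : Tendsto (fun y₁ : ℝ ↦ ∫ y in Ioi y₁, g y) (𝓝[>] 0)
      (𝓝 ((cuspValue32 f A - cuspValue32 f A') / (2 * Real.pi * I))) := by
    have hlim := ((tendsto_const_nhds (x := cuspValue32 f A)).sub
      (tendsto_axisE32_nhdsGT_zero f hN' hPfac)).div_const (2 * Real.pi * I)
    refine hlim.congr' ?_
    filter_upwards [self_mem_nhdsWithin] with y₁ hy₁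
    exact (hA y₁ hy₁).symm
  exact tendsto_nhds_unique TB TC

end Literature.NumberTheory.EllipticCurves.Shintani

noncomputable section

open scoped MatrixGroups ModularForm Modular Topology ENNReal Pointwise Manifold
open UpperHalfPlane hiding I
open Complex Filter MeasureTheory Set CongruenceSubgroup ModularGroup Real MulAction
open Literature.NumberTheory.EllipticCurves.ModularForms

namespace Literature.NumberTheory.EllipticCurves.Shintani

/-! ### `λ² = Δ` -/


/-- The coordinates `v = (k₀, k₁/64, k₂)` of `k ∈ L₃₂ = {64 ∣ k₁}`. [folklore] -/
def vOf32 (k : Fin 3 → ℤ) : Fin 3 → ℤ := ![k 0, k 1 / 64, k 2]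

/-- On `L₃₂`: `Δ(k) = 128 · n₃₂(v)`, `n₃₂(v) = 32 v₁² - v₀ v₂`. [folklore] -/
theorem discK_eq_of_dvd_sixtyfour {k : Fin 3 → ℤ} (h : (64 : ℤ) ∣ k 1) : discK k = 128 * nQ32 (vOf32 k) := by
  obtain ⟨t, ht⟩ := h
  have hdiv : 64 * t / 64 = t := by omega
  rw [discK, nQ32, vOf32, ht]
  simp [hdiv]
  ring

/-! ### The constant: `√(Im z) · λ e(λ² tz) · √(π/(4π t Im z λ²)) = (2√t)⁻¹ sgn(λ) · e(λ² t z)` -/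

variable (cw : (Fin 3 → ℤ) → ℂ) (tS : ℝ) (htS : 0 < tS)

/-- `Im (tz) = t Im z` (as a complex-coordinate statement). [folklore] -/
theorem im_coe_mulPosG (z : ℍ) : (mulPos tS htS z : ℂ).im = tS * z.im := by
  rw [UpperHalfPlane.coe_im, im_mulPos]

/-- **The `z`-dependence of an orbit term is a pure exponential** (generic scale `t`):
`√(Im z) · (λ e(λ² t z)) · √(π/(4π t Im z λ²)) = (2√t)⁻¹ sgn(λ) · e(λ² t z)`. [folklore] -/
theorem sqrt_im_mul_constG (z : ℍ) {lam : ℝ} (hlam : lam ≠ 0) :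
    (Real.sqrt z.im : ℂ) * (((lam : ℂ) * cexp (2 * π * I * (lam ^ 2 : ℝ) * (mulPos tS htS z : ℂ))) *
      (Real.sqrt (π / (4 * π * (mulPos tS htS z : ℂ).im * lam ^ 2)) : ℂ)) =
      (1 / (2 * Real.sqrt tS) * (lam / abs lam) : ℝ) * cexp (2 * π * I * ((lam ^ 2 * tS : ℝ)) * (z : ℂ)) := by
  have hy : 0 < z.im := z.im_pos
  have himZ : (mulPos tS htS z : ℂ).im = tS * z.im := im_coe_mulPosG tS htS z
  have hst : 0 < Real.sqrt tS := Real.sqrt_pos.mpr htS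
  have hexp : cexp (2 * π * I * (lam ^ 2 : ℝ) * (mulPos tS htS z : ℂ)) =
      cexp (2 * π * I * ((lam ^ 2 * tS : ℝ)) * (z : ℂ)) := by
    congr 1; rw [coe_mulPos]; push_cast; ring
  have hsq : Real.sqrt z.im * Real.sqrt (π / (4 * π * (mulPos tS htS z : ℂ).im * lam ^ 2)) =
      1 / (2 * Real.sqrt tS) / abs lam := by
    rw [himZ, ← Real.sqrt_mul hy.le]
    have : z.im * (π / (4 * π * (tS * z.im) * lam ^ 2)) = (1 / (2 * Real.sqrt tS) / abs lam) ^ 2 := by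
      rw [div_pow, div_pow, mul_pow, Real.sq_sqrt htS.le, sq_abs]
      field_simp
      ring
    rw [this, Real.sqrt_sq (by positivity)]
  rw [hexp]
  have key : (Real.sqrt z.im : ℂ) * (((lam : ℂ) * cexp (2 * π * I * ((lam ^ 2 * tS : ℝ)) * (z : ℂ))) *
      (Real.sqrt (π / (4 * π * (mulPos tS htS z : ℂ).im * lam ^ 2)) : ℂ)) =
      ((Real.sqrt z.im * Real.sqrt (π / (4 * π * (mulPos tS htS z : ℂ).im * lam ^ 2)) * lam : ℝ) : ℂ) *
        cexp (2 * π * I * ((lam ^ 2 * tS : ℝ)) * (z : ℂ)) := by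
    push_cast; ring
  rw [key, hsq]
  congr 1
  simp only [Complex.ofReal_mul, Complex.ofReal_div]
  have hl : (Complex.ofReal (abs lam)) ≠ 0 := Complex.ofReal_ne_zero.mpr (abs_ne_zero.mpr hlam)
  field_simp


/-! ### The orbit formulas with data chosen uniformly in `z` -/

/-- `orbitIntegral_anisoG` with `M, λ, κ₀` chosen independently of `z`. [cite: Shintani1975, §2, Prop. 2.3] -/
theorem orbitIntegral_aniso_unifG (f : CuspForm (Gamma0 32) 2)
    (ω : orbitRel.Quotient (Gamma0Plus 32) (Fin 3 → ℤ)) (hpos : 0 < discK ω.out)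
    (hnsq : ¬ IsSquare (discK ω.out)) :
    ∃ (M : SL(2, ℝ)) (lam κ₀ : ℝ), lam ≠ 0 ∧ 1 < κ₀ ∧ actSL M (latSharp32 ω.out) = xyForm lam ∧
      ∀ (cw : (Fin 3 → ℤ) → ℂ) (tS : ℝ) (htS : 0 < tS), InvWeight32 cw → BddWeight cw → ∀ z : ℍ,
        orbitIntegralG cw tS htS f z ω = anisoConstG cw tS htS z ω.out lam *
        rayIntegral (slashSL f M) (π / 2) 1 κ₀ *
          (Real.sqrt (π / (4 * π * (mulPos tS htS z : ℂ).im * lam ^ 2)) : ℝ) := by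
  set k₀ := ω.out with hk₀
  obtain ⟨M, lam, κ₀, m, hlam, hκ, hM, hm, hact⟩ := indef_stabilizer32 k₀ hpos hnsq
  refine ⟨M, lam, κ₀, hlam, hκ, hM, fun cw tS htS hinv _ z ↦ ?_⟩
  have hκ0 : 0 < κ₀ := by linarith
  -- the two fundamental domains of `Γ_{k₀}`
  have hFD := isFundamentalDomain_orbitDomain32 k₀
  have hFD' : IsFundamentalDomain (stabK32 k₀) (M • hannulus κ₀) (volume : Measure ℍ) :=
    isFundamentalDomain_conj_hannulus M hκ m hm (fun γ w ↦ hact γ w)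
  have hstab : ∀ (γ : stabK32 k₀) (w : ℍ), liftTermG cw tS htS f z k₀ (γ • w) = liftTermG cw tS htS f z k₀ w :=
    liftTermG_stab_invariant hinv tS htS f z k₀
  unfold orbitIntegralG
  rw [← hk₀, hFD.setIntegral_eq hFD' hstab, setIntegral_sl_smul_set_real,
    setIntegral_congr_set (hannulus_ae_eq_Ioo κ₀)]
  simp_rw [liftTermG_sl_smul cw tS htS f z hM]
  -- the sibling's evaluation
  obtain ⟨C₀, -, hC₀⟩ := exists_norm_mul_im_le f
  obtain ⟨γ₁, hγ₁⟩ := hm.2 1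
  have hgen : ∀ w : ℍ, (((M⁻¹ • (((γ₁ : Gamma0Plus 32) : SL(2, ℤ)) • w) : ℍ)) : ℂ) =
      ((κ₀ : ℝ) : ℂ) * (((M⁻¹ • w : ℍ)) : ℂ) := by
    intro w; rw [hact γ₁ w, hγ₁, zpow_one]
  have hc : 0 < 4 * π * (mulPos tS htS z : ℂ).im * lam ^ 2 := by
    have h1 : 0 < (mulPos tS htS z : ℂ).im := by rw [UpperHalfPlane.coe_im]; exact (mulPos tS htS z).im_pos
    have h2 : 0 < lam ^ 2 := by positivity
    positivity
  have hCψ : ∀ w : ℂ, 0 < w.im → ‖slashSL f M w * anisoConstG cw tS htS z k₀ lam‖ * w.im ≤ C₀ * ‖anisoConstG cw tS htS z k₀ lam‖ := by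
    intro w hw
    calc ‖slashSL f M w * anisoConstG cw tS htS z k₀ lam‖ * w.im
        = (‖slashSL f M w‖ * w.im) * ‖anisoConstG cw tS htS z k₀ lam‖ := by rw [norm_mul]; ring
      _ ≤ C₀ * ‖anisoConstG cw tS htS z k₀ lam‖ :=
        mul_le_mul_of_nonneg_right (norm_slashSL_mul_im_le32 f M hC₀ hw) (norm_nonneg _)
  have key := setIntegral_upperHalfPlane_annulus_eq (ψ := fun τ ↦ slashSL f M τ * anisoConstG cw tS htS z k₀ lam)
    (c := 4 * π * (mulPos tS htS z : ℂ).im * lam ^ 2) (C := C₀ * ‖anisoConstG cw tS htS z k₀ lam‖) (r₁ := 1) (r₂ := κ₀)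
    ((differentiableOn_slashSL32 f M).mul_const _) hCψ hc one_pos hκ.le
    (fun w hw ↦ slashSL_mul_invG hinv tS htS f z hκ hM hgen hw)
  rw [rayIntegral_mul_const] at key
  rw [← key]


/-- `orbitIntegral_splitG` with `M, λ` chosen independently of `z`. [cite: Shintani1975, §2, Prop. 2.4] -/
theorem orbitIntegral_split_unifG (f : CuspForm (Gamma0 32) 2)
    (ω : orbitRel.Quotient (Gamma0Plus 32) (Fin 3 → ℤ)) {m₀ : ℤ} (hm₀ : 0 < m₀)
    (hΔ : discK ω.out = m₀ ^ 2) :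
    ∃ (M : SL(2, ℝ)) (lam : ℝ), lam ≠ 0 ∧ actSL M (latSharp32 ω.out) = xyForm lam ∧
      ∀ (cw : (Fin 3 → ℤ) → ℂ) (tS : ℝ) (htS : 0 < tS), InvWeight32 cw → BddWeight cw → ∀ z : ℍ,
        orbitIntegralG cw tS htS f z ω = anisoConstG cw tS htS z ω.out lam *
        (∫ r in Ioi (0 : ℝ), slashSL f M (polarPt r (π / 2)) * unitAt (π / 2)) *
          (Real.sqrt (π / (4 * π * (mulPos tS htS z : ℂ).im * lam ^ 2)) : ℝ) := by
  set k₀ := ω.out with hk₀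
  have hposR : 0 < disc (latSharp32 k₀) := by
    rw [disc_latSharp32_eq_discK, hΔ]; push_cast; exact pow_pos (by exact_mod_cast hm₀) 2
  obtain ⟨a, b, c, d, lam, hdet, hlam, hconj⟩ := exists_conj_to_xyForm hposR
  set M : SL(2, ℝ) := slOf a b c d hdet with hMdef
  have hM : actSL M (latSharp32 k₀) = xyForm lam := by rw [hMdef, actSL_slOf]; exact hconj
  refine ⟨M, lam, hlam, hM, fun cw tS htS hinv hb z ↦ ?_⟩
  obtain ⟨⟨A, Nu, hN, hMfac⟩, ⟨A', Nu', hN', hPfac⟩⟩ := exists_factorizations_of_sq32 hm₀ hΔ hM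
  -- trivial stabiliser: `orbitDomain32` and `univ` are both fundamental domains
  have hbot := stabK_eq_bot_of_sq32 hm₀ hΔ (k₀ := k₀)
  haveI : Subsingleton (stabK32 k₀) := by rw [hbot]; infer_instance
  have hFD := isFundamentalDomain_orbitDomain32 k₀
  have hFD' : IsFundamentalDomain (stabK32 k₀) (Set.univ : Set ℍ) (volume : Measure ℍ) :=
    isFundamentalDomain_univ_of_subsingleton
  have hstab : ∀ (γ : stabK32 k₀) (w : ℍ), liftTermG cw tS htS f z k₀ (γ • w) = liftTermG cw tS htS f z k₀ w :=
    liftTermG_stab_invariant hinv tS htS f z k₀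
  -- integrability on `ℍ`, transported and moved to the plane
  have hintH : IntegrableOn (liftTermG cw tS htS f z k₀) Set.univ (volume : Measure ℍ) :=
    (hFD.integrableOn_iff hFD' hstab).mp (tsum_quotient_integral_liftTermG_eq hinv hb tS htS f z k₀).1
  have hintM : IntegrableOn (fun u ↦ liftTermG cw tS htS f z k₀ (M • u)) Set.univ (volume : Measure ℍ) := by
    rw [← integrableOn_sl_smul_set_real_iff M, Set.smul_set_univ]; exact hintH
  set ψ : ℂ → ℂ := fun τ ↦ slashSL f M τ * anisoConstG cw tS htS z k₀ lam with hψdef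
  set cc : ℝ := 4 * π * (mulPos tS htS z : ℂ).im * lam ^ 2 with hcc
  have hcpos : 0 < cc := by
    have h1 : 0 < (mulPos tS htS z : ℂ).im := by rw [UpperHalfPlane.coe_im]; exact (mulPos tS htS z).im_pos
    positivity
  have hplane_eq : ∀ w : ℂ, 0 < w.im →
      ((1 / w.im ^ 2 : ℝ) : ℂ) * liftTermG cw tS htS f z k₀ (M • UpperHalfPlane.ofComplex w) = planeIntegrand ψ cc w := by
    intro w hw
    rw [liftTermG_sl_smul cw tS htS f z hM, planeIntegrand, UpperHalfPlane.ofComplex_apply_of_im_pos hw]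
  have hplane : IntegrableOn (planeIntegrand ψ cc) {w : ℂ | 0 < w.im} := by
    have h := (FdCoord.integrableOn_image_iff (fun u ↦ liftTermG cw tS htS f z k₀ (M • u)) MeasurableSet.univ).mpr hintM
    rw [image_univ, UpperHalfPlane.range_coe] at h
    exact h.congr_fun (fun w hw ↦ hplane_eq w hw) (measurableSet_lt measurable_const Complex.measurable_im)
  -- the sibling's evaluation
  obtain ⟨C₀, -, hC₀⟩ := exists_norm_mul_im_le f
  have hCψ : ∀ w : ℂ, 0 < w.im → ‖ψ w‖ * w.im ≤ C₀ * ‖anisoConstG cw tS htS z k₀ lam‖ := by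
    intro w hw
    calc ‖slashSL f M w * anisoConstG cw tS htS z k₀ lam‖ * w.im
        = (‖slashSL f M w‖ * w.im) * ‖anisoConstG cw tS htS z k₀ lam‖ := by rw [norm_mul]; ring
      _ ≤ C₀ * ‖anisoConstG cw tS htS z k₀ lam‖ :=
        mul_le_mul_of_nonneg_right (norm_slashSL_mul_im_le32 f M hC₀ hw) (norm_nonneg _)
  have hψhol : DifferentiableOn ℂ ψ {w : ℂ | 0 < w.im} := (differentiableOn_slashSL32 f M).mul_const _
  have key := integral_sectorSet_Ioi_eq_mul_sqrt (ψ := ψ) (c := cc) hψhol hCψ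
    (fun y hy ↦ tendsto_slashSL_mul_nhdsGT_zero32 f hN' hPfac _ hy)
    (fun y hy ↦ tendsto_slashSL_mul_atTop32 f hN hMfac _ hy)
    (fun θ hθ ↦ integrableOn_ray32 f hN hMfac hN' hPfac _ hθ)
    (integrableOn_polarIntegrand_of_plane hψhol.continuousOn hplane)
  -- assemble
  unfold orbitIntegralG
  rw [← hk₀, hFD.setIntegral_eq hFD' hstab, ← Set.smul_set_univ (a := M), setIntegral_sl_smul_set_real,
    FdCoord.setIntegral_eq_setIntegral_image _ MeasurableSet.univ, image_univ, UpperHalfPlane.range_coe]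
  rw [show (UpperHalfPlane.upperHalfPlaneSet : Set ℂ) = {w : ℂ | 0 < w.im} from rfl,
    setIntegral_congr_fun (measurableSet_lt measurable_const Complex.measurable_im) (fun w hw ↦ hplane_eq w hw),
    setOf_im_pos_eq_sectorSet, key]
  -- pull the constant out of the ray integral
  have hray : ∫ r in Ioi (0 : ℝ), ψ (polarPt r (π / 2)) * unitAt (π / 2) =
      anisoConstG cw tS htS z k₀ lam * ∫ r in Ioi (0 : ℝ), slashSL f M (polarPt r (π / 2)) * unitAt (π / 2) := by
    rw [← integral_const_mul]
    refine integral_congr_ae (Eventually.of_forall fun r ↦ ?_)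
    simp only [hψdef]; ring
  rw [hray]


/-! ### The orbit term as `coef(ω) · e(n_ω z)` -/

/-- **Uniform orbit data**: for `Δ(k_ω) > 0` there are `λ ≠ 0` with `λ² = Δ(k_ω)` and a
`z`-INDEPENDENT number `P(ω)` (a cycle integral or a cusp-to-cusp period of `φ`) with
`J_z(ω) = c_D(k_ω) λ e(λ²Z) · P(ω) · √(π/(4π Im Z λ²))` for all `z`. [cite: Shintani1975, §2, Props. 2.3–2.4] -/
theorem exists_orbit_dataG (f : CuspForm (Gamma0 32) 2)
    (ω : orbitRel.Quotient (Gamma0Plus 32) (Fin 3 → ℤ)) (hpos : 0 < discK ω.out) :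
    ∃ (lam : ℝ) (P : ℂ), lam ≠ 0 ∧ lam ^ 2 = discK ω.out ∧
      ∀ (cw : (Fin 3 → ℤ) → ℂ) (tS : ℝ) (htS : 0 < tS), InvWeight32 cw → BddWeight cw → ∀ z : ℍ,
        orbitIntegralG cw tS htS f z ω = anisoConstG cw tS htS z ω.out lam * P *
        (Real.sqrt (π / (4 * π * (mulPos tS htS z : ℂ).im * lam ^ 2)) : ℝ) := by
  have hl2 : ∀ {M : SL(2, ℝ)} {lam : ℝ}, actSL M (latSharp32 ω.out) = xyForm lam → lam ^ 2 = discK ω.out := by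
    intro M lam hM
    have h := lam_sq_eq_disc hM
    rw [disc_latSharp32_eq_discK] at h
    exact_mod_cast h
  by_cases hsq : IsSquare (discK ω.out)
  · obtain ⟨r, hr⟩ := hsq
    have hm₀ : 0 < |r| := by
      rcases eq_or_ne r 0 with h0 | h0
      · rw [hr, h0, mul_zero] at hpos; exact absurd hpos (lt_irrefl 0)
      · exact abs_pos.mpr h0
    have hΔ : discK ω.out = |r| ^ 2 := by rw [hr, sq_abs]; ring
    obtain ⟨M, lam, hlam, hM, hJ⟩ := orbitIntegral_split_unifG f ω hm₀ hΔ
    exact ⟨lam, _, hlam, hl2 hM, hJ⟩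
  · obtain ⟨M, lam, κ₀, hlam, -, hM, hJ⟩ := orbitIntegral_aniso_unifG f ω hpos hsq
    exact ⟨lam, _, hlam, hl2 hM, hJ⟩

/-- The `z`-independent coefficient of the orbit `ω`:
`coef(ω) = c(k_ω) · (2√t)⁻¹ sgn(λ) · P(ω)` (and `0` for non-indefinite `ω`). [folklore] -/
def orbCoefG (f : CuspForm (Gamma0 32) 2) (ω : orbitRel.Quotient (Gamma0Plus 32) (Fin 3 → ℤ)) : ℂ :=
  if h : 0 < discK ω.out then
    cw ω.out * ((1 / (2 * Real.sqrt tS) * ((exists_orbit_dataG f ω h).choose / abs (exists_orbit_dataG f ω h).choose) : ℝ) : ℂ) *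
      (exists_orbit_dataG f ω h).choose_spec.choose
  else 0

/-- **The orbit term is an exponential in `z`**:
`√(Im z) · J_z(ω) = coef(ω) · e(t Δ(k_ω) z)` (both sides `0` unless `ω` is indefinite).
[cite: Shintani1975, §2, (2.14)–(2.15)] -/
theorem sqrt_im_mul_orbitTermG {cw : (Fin 3 → ℤ) → ℂ} (hinv : InvWeight32 cw) (hb : BddWeight cw)
    (tS : ℝ) (htS : 0 < tS) (f : CuspForm (Gamma0 32) 2) (z : ℍ)
    (ω : orbitRel.Quotient (Gamma0Plus 32) (Fin 3 → ℤ)) :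
    (Real.sqrt z.im : ℂ) * (if 0 < disc (latSharp32 ω.out) then orbitIntegralG cw tS htS f z ω else 0) =
      orbCoefG cw tS f ω * cexp (2 * π * I * ((tS * discK ω.out : ℝ)) * (z : ℂ)) := by
  have hiff : 0 < disc (latSharp32 ω.out) ↔ 0 < discK ω.out := by
    rw [disc_latSharp32_eq_discK]; exact_mod_cast Iff.rfl
  by_cases hpos : 0 < discK ω.out
  · rw [if_pos (hiff.mpr hpos), orbCoefG, dif_pos hpos]
    set lam := (exists_orbit_dataG f ω hpos).choose with hlamdef
    set P := (exists_orbit_dataG f ω hpos).choose_spec.choose with hPdef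
    obtain ⟨hlam, hl2, hJ⟩ := (exists_orbit_dataG f ω hpos).choose_spec.choose_spec
    rw [hJ cw tS htS hinv hb z, anisoConstG]
    have key := sqrt_im_mul_constG tS htS z hlam
    have hn : ((lam ^ 2 * tS : ℝ)) = tS * discK ω.out := by rw [hl2]; ring
    rw [hn] at key
    calc (Real.sqrt z.im : ℂ) * (cw ω.out * ((lam : ℂ) * cexp (2 * π * I * (lam ^ 2 : ℝ) * (mulPos tS htS z : ℂ))) * P *
          (Real.sqrt (π / (4 * π * (mulPos tS htS z : ℂ).im * lam ^ 2)) : ℂ))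
        = cw ω.out * P * ((Real.sqrt z.im : ℂ) * (((lam : ℂ) * cexp (2 * π * I * (lam ^ 2 : ℝ) * (mulPos tS htS z : ℂ))) *
          (Real.sqrt (π / (4 * π * (mulPos tS htS z : ℂ).im * lam ^ 2)) : ℂ))) := by ring
      _ = cw ω.out * P * ((1 / (2 * Real.sqrt tS) * (lam / abs lam) : ℝ) *
          cexp (2 * π * I * ((tS * discK ω.out : ℝ)) * (z : ℂ))) := by rw [key]
      _ = _ := by push_cast; ring
  · rw [if_neg (fun h ↦ hpos (hiff.mp h)), orbCoefG, dif_neg hpos]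
    simp


/-! ### The `q`-series of the lift -/

/-- The orbit terms `T_z(ω) = √(Im z) · 1_{Δ>0} J_z(ω)` sum to `Φ_D(z)` (a `HasSum`, obtained
fibrewise from the absolutely convergent lattice sum). [cite: Shintani1975, §2, (2.14)] -/
theorem hasSum_orbitTermG {cw : (Fin 3 → ℤ) → ℂ} (hinv : InvWeight32 cw) (hb : BddWeight cw) (tS : ℝ) (htS : 0 < tS)
    (f : CuspForm (Gamma0 32) 2) (z : ℍ) :
    HasSum (fun ω : orbitRel.Quotient (Gamma0Plus 32) (Fin 3 → ℤ) ↦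
      (Real.sqrt z.im : ℂ) * (if 0 < disc (latSharp32 ω.out) then orbitIntegralG cw tS htS f z ω else 0))
      (liftG cw tS htS f z) := by
  have hsum : Summable fun k : Fin 3 → ℤ ↦ ∫ w in liftDomain32, liftTermG cw tS htS f z k w :=
    (summable_norm_integral_liftTermG hb tS htS f z).of_norm
  have hfib := (hsum.hasSum.tsum_fiberwise
    (Quotient.mk'' : (Fin 3 → ℤ) → orbitRel.Quotient (Gamma0Plus 32) (Fin 3 → ℤ))).mul_left (Real.sqrt z.im : ℂ)
  rw [← liftG_eq_tsum_integral tS htS hb f z] at hfib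
  refine hfib.congr_fun fun ω ↦ ?_
  congr 1
  -- the fibre sum over `ω` is the orbit integral (as in `shintaniLift32_eq_tsum_orbitIntegral32`)
  have h1 : ∑' b : ((Quotient.mk'' : (Fin 3 → ℤ) → orbitRel.Quotient (Gamma0Plus 32) (Fin 3 → ℤ)) ⁻¹' {ω}),
      ∫ w in liftDomain32, liftTermG cw tS htS f z (b : Fin 3 → ℤ) w =
      ∑' x : orbitRel.Quotient.orbit ω, ∫ w in liftDomain32, liftTermG cw tS htS f z (x : Fin 3 → ℤ) w :=
    ((Equiv.setCongr (preimage_orbitRel_mk_eq_orbit ω)).symm.tsum_eq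
      (fun x : ((Quotient.mk'' : (Fin 3 → ℤ) → orbitRel.Quotient (Gamma0Plus 32) (Fin 3 → ℤ)) ⁻¹' {ω}) ↦
        ∫ w in liftDomain32, liftTermG cw tS htS f z (x : Fin 3 → ℤ) w)).symm
  rw [h1]
  have hω := Quotient.out_eq' ω
  have h2 : ∑' x : orbitRel.Quotient.orbit ω, ∫ w in liftDomain32, liftTermG cw tS htS f z (x : Fin 3 → ℤ) w =
      ∑' q : Gamma0Plus 32 ⧸ stabK32 ω.out, ∫ w in liftDomain32, liftTermG cw tS htS f z (q.out • ω.out) w := by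
    conv_lhs => rw [← hω]
    exact (tsum_orbitRel_mk_eq (G := Gamma0Plus 32) (fun k : Fin 3 → ℤ ↦ ∫ w in liftDomain32, liftTermG cw tS htS f z k w) ω.out).trans
      (tsum_orbit_eq_tsum_quotient_stabilizer (G := Gamma0Plus 32) (fun k : Fin 3 → ℤ ↦ ∫ w in liftDomain32, liftTermG cw tS htS f z k w) ω.out)
  rw [h2, (tsum_quotient_integral_liftTermG_eq hinv hb tS htS f z ω.out).2]
  split_ifs with h
  · rfl
  · exact (orbitIntegralG_eq_zero_of_disc_nonpos hinv hb tS htS f z ω (not_lt.mp h)).symm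

/-- **The coefficients of the lift** for an INTEGRAL exponent function `e` (with `e(ω) = t Δ(k_ω)` on
the support of the weight): `c(n) = ∑_{ω : e(ω) = n} coef(ω)`. [cite: Shintani1975, §2, (2.15)] -/
def liftCoeffG (e : orbitRel.Quotient (Gamma0Plus 32) (Fin 3 → ℤ) → ℕ) (f : CuspForm (Gamma0 32) 2) (n : ℕ) : ℂ :=
  ∑' ω : (e ⁻¹' {n} : Set (orbitRel.Quotient (Gamma0Plus 32) (Fin 3 → ℤ))), orbCoefG cw tS f ω

/-- `coef(ω) ≠ 0` forces `Δ(k_ω) > 0` and `c(k_ω) ≠ 0`. [folklore] -/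
theorem pos_and_ne_of_orbCoefG_ne_zero (f : CuspForm (Gamma0 32) 2)
    {ω : orbitRel.Quotient (Gamma0Plus 32) (Fin 3 → ℤ)} (h : orbCoefG cw tS f ω ≠ 0) :
    0 < discK ω.out ∧ cw ω.out ≠ 0 := by
  unfold orbCoefG at h
  by_cases hpos : 0 < discK ω.out
  · refine ⟨hpos, fun hc ↦ h ?_⟩
    rw [dif_pos hpos, hc]; simp
  · exact absurd (by rw [dif_neg hpos]) h

variable {cw} in
/-- **The lift is a `q`-series** when the exponents `t Δ(k_ω)` on the support are the naturals `e(ω)`: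
`Φ[c,t](z) = ∑_n c(n) e(nz)`. [cite: Shintani1975, §2, (2.15)] -/
theorem hasSum_liftCoeffG (hinv : InvWeight32 cw) (hb : BddWeight cw)
    (e : orbitRel.Quotient (Gamma0Plus 32) (Fin 3 → ℤ) → ℕ)
    (he : ∀ ω, cw ω.out ≠ 0 → 0 < discK ω.out → ((e ω : ℕ) : ℝ) = tS * discK ω.out)
    (f : CuspForm (Gamma0 32) 2) (z : ℍ) :
    HasSum (fun n : ℕ ↦ liftCoeffG cw tS e f n * Function.Periodic.qParam 1 z ^ n) (liftG cw tS htS f z) := by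
  have h := (hasSum_orbitTermG hinv hb tS htS f z).tsum_fiberwise e
  refine h.congr_fun fun n ↦ ?_
  rw [liftCoeffG, ← tsum_mul_right]
  refine tsum_congr fun ω ↦ ?_
  rw [sqrt_im_mul_orbitTermG hinv hb tS htS f z]
  by_cases hc : orbCoefG cw tS f (ω : orbitRel.Quotient (Gamma0Plus 32) (Fin 3 → ℤ)) = 0
  · rw [hc, zero_mul, zero_mul]
  · obtain ⟨hpos, hne⟩ := pos_and_ne_of_orbCoefG_ne_zero cw tS f hc
    have hn : (tS * discK (ω : orbitRel.Quotient (Gamma0Plus 32) (Fin 3 → ℤ)).out : ℝ) = n := by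
      rw [← he _ hne hpos, show e (ω : orbitRel.Quotient (Gamma0Plus 32) (Fin 3 → ℤ)) = n from ω.2]
    rw [hn]
    congr 1
    rw [Function.Periodic.qParam, ← Complex.exp_nat_mul]
    congr 1
    push_cast
    ring

variable {cw} in
/-- **The `q`-expansion coefficients of the generic lift** (integral exponents). [cite: Shintani1975, §2, (2.15)] -/
theorem qCoeffs_liftG (hinv : InvWeight32 cw) (hb : BddWeight cw)
    (e : orbitRel.Quotient (Gamma0Plus 32) (Fin 3 → ℤ) → ℕ)
    (he : ∀ ω, cw ω.out ≠ 0 → 0 < discK ω.out → ((e ω : ℕ) : ℝ) = tS * discK ω.out)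
    (f : CuspForm (Gamma0 32) 2) :
    qCoeffs (liftG cw tS htS f) = liftCoeffG cw tS e f :=
  qCoeffs_eq_of_hasSum (hasSum_liftCoeffG tS htS hinv hb e he f)

end Literature.NumberTheory.EllipticCurves.Shintani

noncomputable section

open scoped MatrixGroups ModularForm Modular Topology
open UpperHalfPlane hiding I
open Complex Filter MeasureTheory Set CongruenceSubgroup ModularGroup Real MulAction
open Literature.NumberTheory.EllipticCurves.ModularForms

namespace Literature.NumberTheory.EllipticCurves.Shintani

variable (cw : (Fin 3 → ℤ) → ℂ) (tS : ℝ) (htS : 0 < tS)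

/-- The `z`-dependent factor `e(λ²Z) √(π/(4π Im Z λ²))` is non-zero and depends on `λ` only
through `λ²`. [folklore] -/
theorem zFactor_ne_zeroG (z : ℍ) {lam : ℝ} (hlam : lam ≠ 0) :
    cexp (2 * π * I * (lam ^ 2 : ℝ) * (mulPos tS htS z : ℂ)) *
      (Real.sqrt (π / (4 * π * (mulPos tS htS z : ℂ).im * lam ^ 2)) : ℂ) ≠ 0 := by
  refine mul_ne_zero (Complex.exp_ne_zero _) ?_
  have h1 : 0 < (mulPos tS htS z : ℂ).im := by rw [UpperHalfPlane.coe_im]; exact (mulPos tS htS z).im_pos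
  have h2 : 0 < lam ^ 2 := by positivity
  exact Complex.ofReal_ne_zero.mpr (Real.sqrt_pos.mpr (by positivity)).ne'

/-- **Canonicity of `c_D(k) λ P`**: two orbit data `(λ, P)`, `(λ', P')` with `λ² = λ'² = Δ`
describing the same orbit integrals have `c_D(k) λ P = c_D(k) λ' P'`. [folklore] -/
theorem weight_mul_data_eq (z : ℍ) {k : Fin 3 → ℤ} {J : ℂ} {lam lam' : ℝ} {P P' : ℂ}
    (hlam : lam ≠ 0) (hsq : lam ^ 2 = lam' ^ 2)
    (hJ : J = anisoConstG cw tS htS z k lam * P * (Real.sqrt (π / (4 * π * (mulPos tS htS z : ℂ).im * lam ^ 2)) : ℝ))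
    (hJ' : J = anisoConstG cw tS htS z k lam' * P' * (Real.sqrt (π / (4 * π * (mulPos tS htS z : ℂ).im * lam' ^ 2)) : ℝ)) :
    cw k * lam * P = cw k * lam' * P' := by
  have hne := zFactor_ne_zeroG tS htS z hlam
  rw [← hsq] at hJ'
  rw [hJ, anisoConstG, anisoConstG, hsq] at hJ'
  rw [hsq] at hne
  have : (cw k * lam * P) * (cexp (2 * π * I * (lam' ^ 2 : ℝ) * (mulPos tS htS z : ℂ)) *
      (Real.sqrt (π / (4 * π * (mulPos tS htS z : ℂ).im * lam' ^ 2)) : ℂ)) =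
      (cw k * lam' * P') * (cexp (2 * π * I * (lam' ^ 2 : ℝ) * (mulPos tS htS z : ℂ)) *
      (Real.sqrt (π / (4 * π * (mulPos tS htS z : ℂ).im * lam' ^ 2)) : ℂ)) := by
    calc _ = cw k * ((lam : ℂ) * cexp (2 * π * I * (lam' ^ 2 : ℝ) * (mulPos tS htS z : ℂ))) * P *
          (Real.sqrt (π / (4 * π * (mulPos tS htS z : ℂ).im * lam' ^ 2)) : ℂ) := by ring
      _ = cw k * ((lam' : ℂ) * cexp (2 * π * I * (lam' ^ 2 : ℝ) * (mulPos tS htS z : ℂ))) * P' *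
          (Real.sqrt (π / (4 * π * (mulPos tS htS z : ℂ).im * lam' ^ 2)) : ℂ) := hJ'
      _ = _ := by ring
  exact mul_right_cancel₀ hne this

/-- **The coefficient of an orbit in terms of ANY orbit data**: if `(λ, P)` describes the orbit
integrals of `ω` then `coef(ω) = (2√t)⁻¹ · c(k_ω) λ P / √Δ`. [folklore] -/
theorem orbCoefG_eq_of_data {cw : (Fin 3 → ℤ) → ℂ} (hinv : InvWeight32 cw) (hb : BddWeight cw) (tS : ℝ) (htS : 0 < tS)
    (f : CuspForm (Gamma0 32) 2)
    (ω : orbitRel.Quotient (Gamma0Plus 32) (Fin 3 → ℤ)) (hpos : 0 < discK ω.out)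
    {lam : ℝ} {P : ℂ} (hl2 : lam ^ 2 = discK ω.out)
    (hJ : ∀ z : ℍ, orbitIntegralG cw tS htS f z ω = anisoConstG cw tS htS z ω.out lam * P *
      (Real.sqrt (π / (4 * π * (mulPos tS htS z : ℂ).im * lam ^ 2)) : ℝ)) :
    orbCoefG cw tS f ω = ((1 / (2 * Real.sqrt tS) : ℝ) : ℂ) * (cw ω.out * lam * P) / (Real.sqrt (discK ω.out) : ℂ) := by
  rw [orbCoefG, dif_pos hpos]
  set lam₀ := (exists_orbit_dataG f ω hpos).choose
  set P₀ := (exists_orbit_dataG f ω hpos).choose_spec.choose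
  obtain ⟨hlam₀, hl2₀, hJ₀⟩ := (exists_orbit_dataG f ω hpos).choose_spec.choose_spec
  have hsq : lam₀ ^ 2 = lam ^ 2 := by rw [hl2₀, hl2]
  have hcan := weight_mul_data_eq cw tS htS UpperHalfPlane.I hlam₀ hsq (hJ₀ cw tS htS hinv hb UpperHalfPlane.I) (hJ UpperHalfPlane.I)
  have habs : abs lam₀ = Real.sqrt (discK ω.out) := by
    rw [← Real.sqrt_sq_eq_abs, hl2₀]
  have hsqrt_ne : (Real.sqrt (discK ω.out) : ℂ) ≠ 0 := by
    have : (0 : ℝ) < discK ω.out := by exact_mod_cast hpos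
    exact Complex.ofReal_ne_zero.mpr (Real.sqrt_pos.mpr this).ne'
  rw [eq_div_iff hsqrt_ne, ← habs]
  have hl₀ : (Complex.ofReal (abs lam₀)) ≠ 0 := Complex.ofReal_ne_zero.mpr (abs_ne_zero.mpr hlam₀)
  calc cw ω.out * ((1 / (2 * Real.sqrt tS) * (lam₀ / abs lam₀) : ℝ) : ℂ) * P₀ * (abs lam₀ : ℝ)
      = ((1 / (2 * Real.sqrt tS) : ℝ) : ℂ) * (cw ω.out * lam₀ * P₀) * ((lam₀ / abs lam₀ * abs lam₀ / lam₀ : ℝ) : ℂ) := by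
        have hl : (lam₀ : ℂ) ≠ 0 := Complex.ofReal_ne_zero.mpr hlam₀
        push_cast; field_simp
    _ = ((1 / (2 * Real.sqrt tS) : ℝ) : ℂ) * (cw ω.out * lam₀ * P₀) := by
        rw [show (lam₀ / abs lam₀ * abs lam₀ / lam₀ : ℝ) = 1 by
          field_simp [abs_ne_zero.mpr hlam₀]
          exact div_self (mul_ne_zero hlam₀ (abs_ne_zero.mpr hlam₀))]
        simp
    _ = ((1 / (2 * Real.sqrt tS) : ℝ) : ℂ) * (cw ω.out * lam * P) := by rw [hcan]

end Literature.NumberTheory.EllipticCurves.Shintani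

noncomputable section

open scoped MatrixGroups ModularForm Manifold
open UpperHalfPlane hiding I
open Complex Filter Topology CongruenceSubgroup
open Literature.NumberTheory.EllipticCurves.ModularForms

namespace Literature.NumberTheory.EllipticCurves.Shintani

variable (cw : (Fin 3 → ℤ) → ℂ) (tS : ℝ) (htS : 0 < tS)

variable {cw} in
/-- **The generic lift is holomorphic on `ℍ`** (integral exponents). [cite: Shintani1975, §2, Thm. 1] -/
theorem mdifferentiable_liftG (hinv : InvWeight32 cw) (hb : BddWeight cw)
    (e : orbitRel.Quotient (Gamma0Plus 32) (Fin 3 → ℤ) → ℕ)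
    (he : ∀ ω, cw ω.out ≠ 0 → 0 < discK ω.out → ((e ω : ℕ) : ℝ) = tS * discK ω.out)
    (f : CuspForm (Gamma0 32) 2) :
    MDifferentiable 𝓘(ℂ) 𝓘(ℂ) (liftG cw tS htS f) :=
  mdifferentiable_of_hasSum (hasSum_liftCoeffG tS htS hinv hb e he f)

variable {cw} in
/-- **`Φ[c,t] ∈ S_{3/2}(N, χ)` given the kernel's automorphy and the cusp conditions**: holomorphy
is proved (`mdifferentiable_liftG`), automorphy comes from the kernel (`isThetaAutomorphic_liftG`);
the vanishing of `slashSq 3 Φ g` at `i∞` for every `g ∈ SL₂(ℤ)` is a hypothesis here.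
[cite: Shintani1975, §2, Thm. 1] -/
theorem liftG_mem_of_cusp (hinv : InvWeight32 cw) (hb : BddWeight cw)
    (e : orbitRel.Quotient (Gamma0Plus 32) (Fin 3 → ℤ) → ℕ)
    (he : ∀ ω, cw ω.out ≠ 0 → 0 < discK ω.out → ((e ω : ℕ) : ℝ) = tS * discK ω.out)
    {N : ℕ} {χ : DirichletCharacter ℂ N}
    (hK : ∀ w : ℍ, IsThetaAutomorphic 3 N χ (fun z ↦ genKernel32 cw tS htS w z))
    (f : CuspForm (Gamma0 32) 2)
    (hcusp : ∀ g : SL(2, ℤ), IsZeroAtImInfty (slashSq 3 (liftG cw tS htS f) g)) :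
    liftG cw tS htS f ∈ halfIntCuspForms 3 N χ :=
  ⟨mdifferentiable_liftG tS htS hinv hb e he f, isThetaAutomorphic_liftG cw tS htS hK f, hcusp⟩

end Literature.NumberTheory.EllipticCurves.Shintani

noncomputable section

open scoped MatrixGroups ModularForm Modular Topology ENNReal Pointwise Manifold
open UpperHalfPlane hiding I
open Complex Filter MeasureTheory Set CongruenceSubgroup ModularGroup Real MulAction Asymptotics
open Literature.NumberTheory.EllipticCurves.ModularForms

namespace Literature.NumberTheory.EllipticCurves.Shintani

/-! ### The split orbit integral for ANY conjugating matrix -/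

/-- `orbitIntegral_splitG` for an arbitrary `M` with `ι♮(k_ω) ∘ M = λXY`. [cite: Shintani1975, §2, Prop. 2.4] -/
theorem orbitIntegral_split_of_conjG (f : CuspForm (Gamma0 32) 2)
    (ω : orbitRel.Quotient (Gamma0Plus 32) (Fin 3 → ℤ)) {m₀ : ℤ} (hm₀ : 0 < m₀)
    (hΔ : discK ω.out = m₀ ^ 2) {M : SL(2, ℝ)} {lam : ℝ} (hlam : lam ≠ 0)
    (hM : actSL M (latSharp32 ω.out) = xyForm lam) {cw : (Fin 3 → ℤ) → ℂ} (hinv : InvWeight32 cw)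
    (hb : BddWeight cw) (tS : ℝ) (htS : 0 < tS) (z : ℍ) :
    orbitIntegralG cw tS htS f z ω = anisoConstG cw tS htS z ω.out lam *
        (∫ r in Ioi (0 : ℝ), slashSL f M (polarPt r (π / 2)) * unitAt (π / 2)) *
          (Real.sqrt (π / (4 * π * (mulPos tS htS z : ℂ).im * lam ^ 2)) : ℝ) := by
  set k₀ := ω.out with hk₀
  obtain ⟨⟨A, Nu, hN, hMfac⟩, ⟨A', Nu', hN', hPfac⟩⟩ := exists_factorizations_of_sq32 hm₀ hΔ hM
  -- trivial stabiliser: `orbitDomain32` and `univ` are both fundamental domains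
  have hbot := stabK_eq_bot_of_sq32 hm₀ hΔ (k₀ := k₀)
  haveI : Subsingleton (stabK32 k₀) := by rw [hbot]; infer_instance
  have hFD := isFundamentalDomain_orbitDomain32 k₀
  have hFD' : IsFundamentalDomain (stabK32 k₀) (Set.univ : Set ℍ) (volume : Measure ℍ) :=
    isFundamentalDomain_univ_of_subsingleton
  have hstab : ∀ (γ : stabK32 k₀) (w : ℍ), liftTermG cw tS htS f z k₀ (γ • w) = liftTermG cw tS htS f z k₀ w :=
    liftTermG_stab_invariant hinv tS htS f z k₀
  -- integrability on `ℍ`, transported and moved to the plane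
  have hintH : IntegrableOn (liftTermG cw tS htS f z k₀) Set.univ (volume : Measure ℍ) :=
    (hFD.integrableOn_iff hFD' hstab).mp (tsum_quotient_integral_liftTermG_eq hinv hb tS htS f z k₀).1
  have hintM : IntegrableOn (fun u ↦ liftTermG cw tS htS f z k₀ (M • u)) Set.univ (volume : Measure ℍ) := by
    rw [← integrableOn_sl_smul_set_real_iff M, Set.smul_set_univ]; exact hintH
  set ψ : ℂ → ℂ := fun τ ↦ slashSL f M τ * anisoConstG cw tS htS z k₀ lam with hψdef
  set cc : ℝ := 4 * π * (mulPos tS htS z : ℂ).im * lam ^ 2 with hcc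
  have hcpos : 0 < cc := by
    have h1 : 0 < (mulPos tS htS z : ℂ).im := by rw [UpperHalfPlane.coe_im]; exact (mulPos tS htS z).im_pos
    positivity
  have hplane_eq : ∀ w : ℂ, 0 < w.im →
      ((1 / w.im ^ 2 : ℝ) : ℂ) * liftTermG cw tS htS f z k₀ (M • UpperHalfPlane.ofComplex w) = planeIntegrand ψ cc w := by
    intro w hw
    rw [liftTermG_sl_smul cw tS htS f z hM, planeIntegrand, UpperHalfPlane.ofComplex_apply_of_im_pos hw]
  have hplane : IntegrableOn (planeIntegrand ψ cc) {w : ℂ | 0 < w.im} := by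
    have h := (FdCoord.integrableOn_image_iff (fun u ↦ liftTermG cw tS htS f z k₀ (M • u)) MeasurableSet.univ).mpr hintM
    rw [image_univ, UpperHalfPlane.range_coe] at h
    exact h.congr_fun (fun w hw ↦ hplane_eq w hw) (measurableSet_lt measurable_const Complex.measurable_im)
  -- the sibling's evaluation
  obtain ⟨C₀, -, hC₀⟩ := exists_norm_mul_im_le f
  have hCψ : ∀ w : ℂ, 0 < w.im → ‖ψ w‖ * w.im ≤ C₀ * ‖anisoConstG cw tS htS z k₀ lam‖ := by
    intro w hw
    calc ‖slashSL f M w * anisoConstG cw tS htS z k₀ lam‖ * w.im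
        = (‖slashSL f M w‖ * w.im) * ‖anisoConstG cw tS htS z k₀ lam‖ := by rw [norm_mul]; ring
      _ ≤ C₀ * ‖anisoConstG cw tS htS z k₀ lam‖ :=
        mul_le_mul_of_nonneg_right (norm_slashSL_mul_im_le32 f M hC₀ hw) (norm_nonneg _)
  have hψhol : DifferentiableOn ℂ ψ {w : ℂ | 0 < w.im} := (differentiableOn_slashSL32 f M).mul_const _
  have key := integral_sectorSet_Ioi_eq_mul_sqrt (ψ := ψ) (c := cc) hψhol hCψ
    (fun y hy ↦ tendsto_slashSL_mul_nhdsGT_zero32 f hN' hPfac _ hy)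
    (fun y hy ↦ tendsto_slashSL_mul_atTop32 f hN hMfac _ hy)
    (fun θ hθ ↦ integrableOn_ray32 f hN hMfac hN' hPfac _ hθ)
    (integrableOn_polarIntegrand_of_plane hψhol.continuousOn hplane)
  -- assemble
  unfold orbitIntegralG
  rw [← hk₀, hFD.setIntegral_eq hFD' hstab, ← Set.smul_set_univ (a := M), setIntegral_sl_smul_set_real,
    FdCoord.setIntegral_eq_setIntegral_image _ MeasurableSet.univ, image_univ, UpperHalfPlane.range_coe]
  rw [show (UpperHalfPlane.upperHalfPlaneSet : Set ℂ) = {w : ℂ | 0 < w.im} from rfl,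
    setIntegral_congr_fun (measurableSet_lt measurable_const Complex.measurable_im) (fun w hw ↦ hplane_eq w hw),
    setOf_im_pos_eq_sectorSet, key]
  -- pull the constant out of the ray integral
  have hray : ∫ r in Ioi (0 : ℝ), ψ (polarPt r (π / 2)) * unitAt (π / 2) =
      anisoConstG cw tS htS z k₀ lam * ∫ r in Ioi (0 : ℝ), slashSL f M (polarPt r (π / 2)) * unitAt (π / 2) := by
    rw [← integral_const_mul]
    refine integral_congr_ae (Eventually.of_forall fun r ↦ ?_)
    simp only [hψdef]; ring
  rw [hray]


/-! ### The explicit conjugating matrix with `λ = +√Δ` and columns at the roots -/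


/-! ### Identifying the cusps `A∞ = M∞`, `A'∞ = M0` -/


/-- The cusp value at a factorization: `cuspValue32 φ A = {∞, q}` when `(q : ℝ) = M₀₀/M₁₀`. [folklore] -/
theorem cuspValue32_eq_modularSymbol (f : CuspForm (Gamma0 32) 2) {M : SL(2, ℝ)} {A : SL(2, ℤ)} {Nu : SL(2, ℝ)}
    (hN : (Nu 1 0 : ℝ) = 0) (hMfac : M = ((A : SL(2, ℤ)) : SL(2, ℝ)) * Nu) (hM10 : (M 1 0 : ℝ) ≠ 0)
    {q : ℚ} (hq : (q : ℝ) = (M 0 0 : ℝ) / (M 1 0 : ℝ)) :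
    cuspValue32 f A = modularSymbol f q := by
  obtain ⟨hA10, hratio⟩ := ratio_of_fac hN hMfac hM10
  rw [cuspValue32, if_neg hA10]
  congr 1
  have : ((((A 0 0 : ℤ) : ℚ) / ((A 1 0 : ℤ) : ℚ) : ℚ) : ℝ) = (q : ℝ) := by
    push_cast; rw [hratio, hq]
  exact_mod_cast this

/-! ### The explicit coefficient of a split orbit -/

variable (cw : (Fin 3 → ℤ) → ℂ) (tS : ℝ) (htS : 0 < tS)

/-- **The coefficient of a split orbit by modular symbols**: for `ω` with `Δ(k_ω) = m₀² > 0` and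
`x₀ = 32k₀ ≠ 0`, with the root cusps `q₁ = (-x₁ - m₀)/(2x₀)`, `q₂ = (-x₁ + m₀)/(2x₀)`,
`coef(ω) = (2√t)⁻¹ · c(k_ω) · ({∞, q₁}_φ - {∞, q₂}_φ)/(2πi)`.
[cite: Shintani1975, §2, Lemma 2.7 (ii) and §3] -/
theorem orbCoefG_split_explicit {cw : (Fin 3 → ℤ) → ℂ} (hinv : InvWeight32 cw) (hb : BddWeight cw) (tS : ℝ) (htS : 0 < tS)
    (f : CuspForm (Gamma0 32) 2)
    (ω : orbitRel.Quotient (Gamma0Plus 32) (Fin 3 → ℤ)) {m₀ : ℤ} (hm₀ : 0 < m₀)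
    (hΔ : discK ω.out = m₀ ^ 2) (hx0 : latSharp32 ω.out 0 ≠ 0) {q₁ q₂ : ℚ}
    (hq₁ : (q₁ : ℝ) = (-latSharp32 ω.out 1 - m₀) / (2 * latSharp32 ω.out 0))
    (hq₂ : (q₂ : ℝ) = (-latSharp32 ω.out 1 + m₀) / (2 * latSharp32 ω.out 0)) :
    orbCoefG cw tS f ω = ((1 / (2 * Real.sqrt tS) : ℝ) : ℂ) * cw ω.out *
      ((modularSymbol f q₁ - modularSymbol f q₂) / (2 * Real.pi * I)) := by
  set x := latSharp32 ω.out with hx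
  have hdiscR : disc x = ((m₀ : ℝ)) ^ 2 := by
    rw [hx, disc_latSharp32_eq_discK, hΔ]; push_cast; ring
  have hposR : 0 < disc x := by rw [hdiscR]; exact pow_pos (by exact_mod_cast hm₀) 2
  have hpos : 0 < discK ω.out := by rw [hΔ]; positivity
  have hsqrt : Real.sqrt (disc x) = m₀ := by rw [hdiscR, Real.sqrt_sq (by exact_mod_cast hm₀.le)]
  obtain ⟨a, b, c, d, hdet, hM, hc, hd0, hcol1, hcol2⟩ := exists_conj_explicit hx0 hposR
  rw [hsqrt] at hM hcol1 hcol2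
  set M : SL(2, ℝ) := slOf a b c d hdet with hMdef
  have hm₀R : (m₀ : ℝ) ≠ 0 := by exact_mod_cast hm₀.ne'
  obtain ⟨⟨A, Nu, hN, hMfac⟩, ⟨A', Nu', hN', hPfac⟩⟩ := exists_factorizations_of_sq32 hm₀ hΔ hM
  -- the orbit data `(m₀, P)` with `P` the cusp-to-cusp period
  have hJ : ∀ z : ℍ, orbitIntegralG cw tS htS f z ω = anisoConstG cw tS htS z ω.out m₀ *
      (∫ r in Ioi (0 : ℝ), slashSL f M (polarPt r (π / 2)) * unitAt (π / 2)) *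
        (Real.sqrt (π / (4 * π * (mulPos tS htS z : ℂ).im * (m₀ : ℝ) ^ 2)) : ℝ) :=
    fun z ↦ orbitIntegral_split_of_conjG f ω hm₀ hΔ hm₀R hM hinv hb tS htS z
  have hl2 : (m₀ : ℝ) ^ 2 = discK ω.out := by rw [hΔ]; push_cast; ring
  rw [orbCoefG_eq_of_data hinv hb tS htS f ω hpos hl2 hJ, period_eq_cuspValue32_sub f hN hMfac hN' hPfac]
  -- the cusps
  have hM10 : (M 1 0 : ℝ) ≠ 0 := by simp [hMdef, slOf, hc]
  have hM00 : (M 0 0 : ℝ) / (M 1 0 : ℝ) = a / c := by simp [hMdef, slOf]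
  obtain ⟨hP00, hP10⟩ := mul_S_inv_col M
  have hP10ne : ((M * (((ModularGroup.S : SL(2, ℤ)) : SL(2, ℝ)))⁻¹ : SL(2, ℝ)) 1 0 : ℝ) ≠ 0 := by
    rw [hP10]; simp [hMdef, slOf, hd0]
  have hPratio : ((M * (((ModularGroup.S : SL(2, ℤ)) : SL(2, ℝ)))⁻¹ : SL(2, ℝ)) 0 0 : ℝ) /
      ((M * (((ModularGroup.S : SL(2, ℤ)) : SL(2, ℝ)))⁻¹ : SL(2, ℝ)) 1 0 : ℝ) = b / d := by
    rw [hP00, hP10, neg_div_neg_eq]; simp [hMdef, slOf]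
  rw [cuspValue32_eq_modularSymbol f hN hMfac hM10 (q := q₁) (by rw [hq₁, hM00, hcol1]),
    cuspValue32_eq_modularSymbol f hN' hPfac hP10ne (q := q₂) (by rw [hq₂, hPratio, hcol2])]
  -- `√Δ = m₀`
  have hsq : Real.sqrt (discK ω.out : ℝ) = m₀ := by
    rw [← hl2, Real.sqrt_sq (by exact_mod_cast hm₀.le)]
  rw [hsq]
  have hm₀C : ((m₀ : ℝ) : ℂ) ≠ 0 := Complex.ofReal_ne_zero.mpr hm₀R
  field_simp

end Literature.NumberTheory.EllipticCurves.Shintani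

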